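import Literature.Geometry.Lorentzian.Hintz2026.KerrTrappingPhasePortrait
import Literature.Analysis.Calculus.ParametricCrossingTime

/-!
# Hintz 2026 [AF] §4.2.3 "Trapping II": Lemma 4.14 / (4.44)–(4.46) / Def. 4.15 / Lemma 4.16 — the CONIC structure of the
# trapped set and the REGULARITY of the trapped radius `r'_{(z,ζ)}`: `r'` is a real-analytic implicit function of the
# conserved fibre data `(σ, η_ϕ)` (from `∂_rΨ(r') ≠ 0`), homogeneous of degree `0`, continuous along `Γ̃₀` by the compactness
# (4.43), so that every trapped-radius selection on `Γ̃₀` is `C^ω` and `Γ̃₀ = Π(Γ₀)` is a regular level set (`∂_σG_3b ≠ 0` on `Σ⁺`)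
# — reproduced in the kernel for all `|a| < 𝔪` (the local statements for all `a² ≤ 𝔪²`)

#harness_tags [topic Geometry/Lorentzian]

CITATION HEADER (lean-in-tree rule 2026-08-18).  P. Hintz, *(Non-)Linear waves on asymptotically flat spacetimes. II*,
arXiv:2606.28008 **v1** (2026), bib key `Hintz2026WavesII` ("[AF]"; an UNREFEREED companion of the claim under adjudication
P. Hintz, *Nonlinear stability of subextremal Kerr black holes*, arXiv:2606.28253 **v2**, bib `Hintz2026`, "H"); "[AF] l.N" =
line N of its TeX source `nonstat2.tex` (md5 43f4362591de), numbers as in the `nonstat2.aux` shipped with H (= the public v1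
PDF: Def. 4.13 `DefTs3bOTrap0`, (4.43) `EqTs3bOTrap0Cpt`, Lemma 4.14 `LemmaTs3bOTrap0Reg`, (4.44) `EqTs3bOTrap0RegDiff`, (4.45)
`EqTs3bOTrapProj`, (4.46) `EqTs3bOTrapwtGamma0`, Def. 4.15 `DefTs3bOTrapus0`, Lemma 4.16 `LemmaTs3bOTrapwtGamma`, Def. 4.17 /
(4.47) `DefTs3bODefFn`; printed pp.88–89 = v1 PDF pp.124–125); "H l.N" = line N of `kerr-stab-r.tex` (md5 2c6513182847).  The
REFEREED anchor is S. Dyatlov, *Asymptotics of linear waves and resonances with applications to black holes*, Comm. Math.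
Phys. 335 (2015) 1445–1485 (bib `Dyatlov2015`; held arXiv:1305.1723, whose §2.x / Prop. 2.x = journal §3.x / Prop. 3.x): his Prop. 3.3
(held text Prop. 2.3, p.16) prints "The set `K̃` … is a smooth codimension 2 submanifold of `{p̃ = 0} ∖ 0`, and its projection `K̂` onto
the `x̂ = (t, θ, φ), ξ̂ = (τ, ξ_θ, ξ_φ)` variables is a smooth codimension 1 submanifold of `T*(ℝ × 𝕊²)`" (proof, p.16: "at each point of
`K̃` the matrix of partial derivatives `G, ξ_r, ∂_rG` in the variables `(r, ξ_r, *)` … is invertible"), and his Prop. 3.5 (held Prop. 2.5,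
p.17) "`r'_{x̂,ξ̂}` is the only solution to the equation `Φ_{x̂,ξ̂}(r) = 0`", "`Γ̃_±` are conic smooth codimension 1 submanifolds …
intersecting transversely"; [AF] l.4500: "The following analysis of the dynamics in `r > r₊` closely follows Dyatlov".  Written by the audit
cell `pub-kerr` (HINTZ-PLAN.md HP-44; GAPS.md C-A28; ADEP.md §D.25), fourth of the trapping-leaf series after module
`KerrTrappedSet` ("Trapping II": `Γ₀`, (4.43)–(4.44), HP-41), module `KerrTrappedSetDynamics` ("Trapping III–IV", HP-42) and
module `KerrTrappingPhasePortrait` ("Trapping I/III": the `(r, ξ)` phase portrait, HP-43), which it imports; it discharges the part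
of their common scope note "NOT formalised: … Lemma 4.16 (manifold / smoothness / homogeneity statements, `Γ̃₀`), Def. 4.17's
extensions …" that is finite-dimensional calculus: the implicit function theorem is taken from the tree
(`Literature.Analysis.Calculus.exists_contDiffOn_crossingTime` = Mathlib's `ContDiffAt.implicitFunction` with a uniqueness window)
and the tube lemma from Mathlib (`IsCompact.eventually_forall_of_forall_eventually`).  Nothing here is an estimate or a statement
about perturbed metrics; no flow is constructed.

## What is printed, and where it enters H

* H Prop. 8.3 `PropWETr` (H l.7395–7403) imports [AF]'s trapping structure on exact Kerr wholesale: [AF] Prop. 6.3 `PropDyTr`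
  ("upon setting `φ^{u/s} := φ₀^{u/s} + φ̃^{u/s}`", l.5788–5799) and §9.1.2 l.7888–7896 consume the DEFINING FUNCTIONS (4.47), which
  are functions on phase space only because "`r'_{(z,ζ)}` is smooth" (Lemma 4.16(1)) — Def. 4.17 opens with "Lemma 4.16 enables us
  to introduce smooth defining functions of `Γ₀^{u/s}`" (l.4686).
* [AF] Def. 4.13 `DefTs3bOTrap0` (l.4607–4613) and its gloss l.4615: "a point … lies in `Γ₀` if and only if `ξ = 0` and `Φ⁰_{(z⁰,ζ⁰)}`
  … has a double zero at `r`"; **(4.43)** "`Γ₀ ⊂ r⁻¹((r_{Γ,−}, r_{Γ,+}))`" (l.4615–4619; kernel: the sharp photon shell of modules 76/78).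
* [AF] **Lemma 4.14** `LemmaTs3bOTrap0Reg` (l.4621–4638): "`Γ₀` is a smooth conic codimension 2 submanifold of `Σ⁺ ∩ T*𝓜` … `σ > 0`
  and `𝒞 > 0` on `Γ₀`", proof: "these are equivalent to `(ξ, Ψ, G_3b) = (0,0,0)`.  We thus only need to show that at `Γ₀`, the
  differentials of `ξ, Ψ, G_3b` are linearly independent.  But at `Γ₀`, **(4.44)** `∂_ξξ = 1, ∂_ξΨ = 0, ∂_ξG_3b = 0; ∂_rΨ ≠ 0,
  ∂_rG_3b = 0; ∂_σG_3b = −2ϱ²g⁻¹(d𝔱,·)`" (kernel: module 76 `jac`, `jac_det_ne_zero`, `carterC_pos`, `sigma_pos_on_SigmaPlus`).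
* [AF] **(4.45)** "Define the projection `Π : (r, z; ξ, ζ) ↦ (z, ζ)` along `T*(r₊,∞)`" and **(4.46)** "`Γ̃₀ := Π(Γ₀) = {(z,ζ) ∈
  T*(ℝ_𝔱 × 𝕊²) : ∃ r' > r₊ such that (r', z; 0, ζ) ∈ Γ₀}`.  Thus, `Γ̃₀` consists of all `(z⁰, ζ⁰)` for which there exists
  `r' ∈ (r₊, ∞)` (which is then necessarily unique) satisfying (4.37)" (l.4640–4650).
* [AF] **Def. 4.15** `DefTs3bOTrapus0` (l.4652–4660): `Γ₀^{u/s} := ⋃_{(z,ζ) ∈ Γ̃₀} {(r, z; ξ, ζ) : (r, ξ) ∈ Γ^{u/s}_{(z,ζ)}} = {(r,z;ξ,ζ) :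
  r > r₊, ξ = ±sgn(r − r'_{(z,ζ)})√(−Φ⁰_{(z,ζ)}(r)/μ(r))}`, "where … `r'_{(z,ζ)}` is the unique zero of `Φ⁰_{(z,ζ)}(r)` in `r > r₊`";
  "Directly from the definitions, we have `Γ₀ = Γ₀^u ∩ Γ₀^s`" (l.4662–4664; kernel: module 81 `gamma0_fibre`).
* [AF] **Lemma 4.16** `LemmaTs3bOTrapwtGamma` (l.4668–4682; items (1)/(2) at l.4672/l.4673): "(1) The set `Γ̃₀ ⊂ T*(ℝ_𝔱 × 𝕊²)` is a smooth conic codimension 1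
  submanifold.  The map `Γ̃₀ ∋ (z,ζ) ↦ r'_{(z,ζ)} ∈ (r₊,∞)` is smooth and homogeneous of degree 0 with respect to dilations in `ζ`.
  (2) The sets `Γ₀^{u/s}` are smooth conic codimension 1 submanifolds of `Σ⁺ ∩ T*𝓜` which … intersect transversally at `Γ₀`."  PROOF
  (l.4676–4682; sentences l.4677 / l.4679 / l.4681): "We first claim that `T_ϖΓ₀ ∩ ker D_ϖΠ = {0}`.  … given `v = a∂_r + b∂_ξ ∈ ker D_ϖΠ`, we get `0 = dξ(v) = b`, so
  `b = 0`, and then `dΨ(v) = a∂_rΨ = 0` forces `a = 0` by (4.44) … `[Γ₀] ⊂ S*𝓜/ℝ_𝔱` is compact by (4.43), and we have just shown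
  that `[Π] : [Γ₀] → S*(ℝ_𝔱 × 𝕊²)/ℝ_𝔱` is a smooth immersion which, moreover, is injective due to the uniqueness of `r'` in (4.46);
  therefore, it is an embedding.  This shows that `Γ̃₀` is a smooth codimension 1 submanifold.  Furthermore, the smoothness of the
  inverse `(Π_{Γ₀})⁻¹ : Γ̃₀ → Γ₀` gives the smoothness of `r'_{(z,ζ)}` … The homogeneity in `ζ` is clear.  Part (2) now follows from
  the definition of `Γ₀^{u/s}`, with the transversality being a consequence of the fact that `Φ⁰_{(z,ζ)}` has a non-degenerate
  maximum at `r = r'_{(z,ζ)}` by Lemma 4.12."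
* [AF] Def. 4.17 / **(4.47)** (l.4688–4696) and the remark l.4698: "`Φ⁰_{(z,ζ)}` is homogeneous of degree 2 since `V, 𝒞` are …, so (4.47) is
  homogeneous of degree 1.  Note also that `Γ₀^{u/s}` has codimension 1 inside of `Γ̃₀ × T*(r₊,∞)`, and `φ₀^{u/s}` is a defining
  function in `Γ̃₀ × T*(r₊,∞)`."

## What the kernel certifies (real parameters `𝔪, a`; fibre data `ζ = (σ, η_θ, η_ϕ)` over `sin²θ = s2`, or the REDUCED data
## `(σ, η_ϕ, C)` with the Carter VALUE `C` of module 81; `μ = r² − 2𝔪r + a²`; `a² = 𝔪² − s²`)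

§1 THE CONIC STRUCTURE ("homogeneous … with respect to dilations in `ζ`"): under `ζ ↦ tζ` (and `ξ ↦ tξ`, `C ↦ t²C`) the printed
functions scale as `A, B, ϱ²g⁻¹(d𝔱,·) ∝ t`; `V, Ψ, 𝒞` (both charts), `𝒢, G_3b, Φ⁰, 𝒢⁰, ∂_rΦ⁰, ∂_rΨ, ∂_r²Φ ∝ t²`; `ν²` (4.49) is
INVARIANT (`nuSq_smul`: the expansion rate lives on the quotient `S*`); Def. 4.13's triple and the future half are invariant
(`onGamma0_smul_iff`, `onGamma0Pol_smul_iff` for `t ≠ 0`, `inSigmaPlus_smul_iff` for `t > 0`); the double-zero condition (4.37) is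
invariant (`trapped_fibre_smul_iff`), whence **`r'_{(z,tζ)} = r'_{(z,ζ)}`** (`trapped_radius_smul`, with module 81's uniqueness) —
"homogeneous of degree 0"; and (4.47): `u ∝ t²`, `sgn(r−r')√u ∝ |t|`, **`φ₀^{u/s}(tξ, tζ) = tφ₀^{u/s}(ξ, ζ)` for `t > 0`** (`phiU_smul`,
`phiS_smul`; l.4698 "homogeneous of degree 1"), while a NEGATIVE dilation (the reflection `Σ⁺ → Σ⁻`) SWAPS them:
`φ₀^u(tξ, tζ) = tφ₀^s(ξ, ζ)` for `t < 0` (`phiU_smul_of_neg`, `phiS_smul_of_neg`; computed here).  Euler's relation for the degree-2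
polynomial `Ψ`: **`σ∂_σΨ + η_ϕ∂_{η_ϕ}Ψ = 2Ψ`** (`euler_Psi`, with the certified `∂_{η_ϕ}Ψ`, `hasDerivAt_Psi_etaphi`, next to module 76's
`∂_σΨ`).
§2 (4.44) ⇒ THE FIRST CLAIM OF LEMMA 4.16's PROOF: with module 76's Jacobian `jac` (rows `dξ, dΨ, dG_3b`, columns `∂_ξ, ∂_r, ∂_σ`), a
vector `v = α∂_r + β∂_ξ` of `ker DΠ` with `dξ(v) = 0`, `dΨ(v) = 0` is zero as soon as `∂_rΨ ≠ 0` (`ker_dPi_trivial`) — "`Π|_{Γ₀}` is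
an immersion".
§3 **LEMMA 4.16(1), LOCAL FORM — THE TRAPPED RADIUS IS A REAL-ANALYTIC IMPLICIT FUNCTION OF `(σ, η_ϕ)`.**  `Ψ` is a polynomial in
`(r, σ, η_ϕ)` (`contDiff_Psi`, class `C^ω` jointly) with `∂_rΨ(r') > 0` at every trapped point (module 76 `dPsi_pos`: `a² ≤ 𝔪²`,
`r' > 𝔪 ≥ 0`, `μ > 0`, `A ≠ 0`), so the tree's implicit function theorem yields a `RadiusChart` (`nonempty_radiusChart`): radii
`ε, δ > 0` and `ρ : ℝ² → ℝ` of class **`C^ω` on the ball `B((σ₀, η₀), ε)`** with `ρ(σ₀, η₀) = r'`, `Ψ(ρ(σ,η); σ, η) = 0`,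
`ρ ∈ (r' − δ, r' + δ)`, and `ρ(σ, η)` the ONLY root of `Ψ(·; σ, η)` in that window.  Consequences: **dilation invariance**
`ρ(tσ, tη) = ρ(σ, η)` (`RadiusChart.smul_eq`, from `Ψ(r; tζ) = t²Ψ(r; ζ)` and the uniqueness window — degree-0 homogeneity again,
now of the smooth function); the CERTIFIED PARTIALS **`∂_σr' = −∂_σΨ/∂_rΨ`, `∂_{η_ϕ}r' = −∂_{η_ϕ}Ψ/∂_rΨ`** (`RadiusChart.hasDerivAt_sigma
/_etaphi`, by differentiating `Ψ(ρ, σ, η) ≡ 0` with the total-derivative lemma `hasDerivAt_Psi_comp` and uniqueness of derivatives)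
and hence, by Euler, **`σ∂_σr' + η_ϕ∂_{η_ϕ}r' = −2Ψ/∂_rΨ = 0`** (`RadiusChart.dilation_deriv_eq_zero`) — the infinitesimal form of
"homogeneous of degree 0".
§4 **LEMMA 4.16(1), THE EMBEDDING STEP ("`[Γ₀]` compact by (4.43) + injective ⇒ embedding") AS CONTINUITY, AND THE GLOBAL
STATEMENT.**  `Φ⁰` is jointly continuous in (data, `r`) off `{μ = 0}` (`continuousAt_Phi0`); for reduced data `p₀ = (σ₀, η₀, C₀)`,
`C₀ > 0`, with trapped radius `r₀ > r₊` and any compact radial range `[L, U] ⊂ (r₊, ∞)`: by (4.38) (module 81 `Phi0_neg_of_ne`)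
`Φ⁰_{p₀} ≠ 0` on the compact `[L, U] ∖ (r₀ − δ, r₀ + δ)`, so by the tube lemma **data near `p₀` carry NO double zero there**
(`eventually_not_trapped_off_window`), hence **any trapped radius in `[L, U]` of nearby data lies in the window and EQUALS
`ρ(σ, η)`** (`eventually_radius_eq_chart`) — `Γ₀` is locally the graph of `ρ` over `Γ̃₀`, i.e. `(Π|_{Γ₀})⁻¹ = (z,ζ) ↦ (ρ(σ,η_ϕ), z; 0, ζ)`.
Therefore (`contDiffOn_radius_selection`): **every selection `R` of trapped radii in `[L, U]` on a set `D` of reduced data with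
`C > 0` is `C^ω` on `D`** (`ContDiffOn ℝ ω R D`: at each point `R` agrees, within `D`, with the analytic `ρ ∘ (σ, η_ϕ)`).  ON `Γ₀`
PROPER (`a² = 𝔪² − s²`, `s > 0`, `𝔪 > 0`): the range `[L, U]` is the photon shell `[r_ph⁺, r_ph⁻]`, `r_ph⁺ ≥ r₊ + s²/(3𝔪) > r₊`
(modules 76/78 `trapped_radius_shell(_pol)`, `shell_bounds` = (4.43)) and `C = 𝒞(ζ) > 0` (Lemma 4.14), so with **`Γ̃₀`
TRANSCRIBED** in the Boyer–Lindquist chart (`tildeGamma0`: data `(sin²θ, σ, η_θ, η_ϕ)`, `0 < sin²θ ≤ 1`, off `o`, `∃ r' > r₊` with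
Def. 4.13's triple and `Σ⁺`) and in the polar chart of module 78 (`tildeGamma0Pol`: `(ω, σ, η₁, η₂)`, `|ω| < 1`, poles included):
**every trapped-radius selection on `Γ̃₀` is `C^ω` on `Γ̃₀`** (`contDiffOn_trappedRadius_bl`, `contDiffOn_trappedRadius_pol`) —
Lemma 4.16(1)'s "smooth" (indeed analytic, as [AF] l.4579 remarks for `Γ^{u/s}`), and `Γ̃₀` is a cone (`smul_mem_tildeGamma0(_Pol)`).
§5 **`Γ̃₀` AS A REGULAR LEVEL SET ("smooth conic codimension 1 submanifold").**  In a chart, near `(z₀, ζ₀) ∈ Γ̃₀`: for data in the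
ball and radii in the window, Def. 4.13's triple holds at `(r, z; 0, ζ)` **iff `r = ρ(σ, η_ϕ)` and `F(z, ζ) := G_3b(ρ(σ,η_ϕ), z; 0, ζ)
= 0`** (`onGamma0_iff_chart`, `onGamma0Pol_iff_chart`); the level function has the certified `σ`-derivative **`∂_σF = (∂_rG_3b)∂_σρ
+ ∂_σG_3b = 0·∂_σρ − 2ϱ²g⁻¹(d𝔱, ζ)`** (`hasDerivAt_level_sigma`, via the total derivative `hasDerivAt_Vfn_comp` and "`∂_rG_3b = 0`"
of (4.44) at `Ψ = 0`), **nonzero on `Σ⁺`** (`level_sigma_ne_zero`, module 76 (4.41)–(4.42)) — so `{F = 0}` is a regular level set,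
transverse to the `σ`-lines (both charts: `hasDerivAt_levelPol_sigma`, `levelPol_sigma_ne_zero` over the poles).  §5b THE SECOND
IMPLICIT-FUNCTION STEP, carried out: `F` is `C^ω` jointly (`contDiffAt_level(_Pol)`: the analytic chart composed with the rational
`G_3b`, `contDiffAt_G3b_of` / `contDiffAt_G3bpol_of`), so at every point of `Γ₀ ∩ Σ⁺` (any `a` with `μ(r₀) ≠ 0`) an `EnergyChart`
exists (`nonempty_energyChart`, `nonempty_energyChartPol`): a real-analytic **`S(sin²θ, η_θ, η_ϕ)`** (resp. `S(ω, η)`, poles included)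
with `S(x₀) = σ₀`, `F(x, S x) = 0` and `S x` the only zero of `F(x, ·)` in a window — **`Γ̃₀` is locally the graph `σ = S` of an
analytic energy function over the momenta**, and combining the two charts (`onGamma0_iff_graph`, `onGamma0Pol_iff_graph`): **inside
the charts, Def. 4.13's triple holds at `(r, z; σ, 0, η)` iff `σ = S(x)` and `r = ρ(σ, η_ϕ)`** — `Γ₀` is a real-analytic graph over
the five free coordinates `(t, ϕ; θ, η_θ, η_ϕ)`, i.e. Lemma 4.14's "codimension 3 within `T*𝓜`" and Lemma 4.16(1)'s "codimension 1"
in coordinates.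
§6 LEMMA 4.16(2) AT THE LEVEL OF DIFFERENTIALS: in the `(r, ξ)`-plane the differentials of `φ₀^u, φ₀^s` at `(r', 0)` are `(−c, 1)`,
`(c, 1)` with module 81's slope `c = √(−∂_r²Φ⁰(r')/(2μ(r'))) > 0`, and `det [[−c, 1], [c, 1]] = −2c ≠ 0` (`transversal_at_rprime`;
module 81 `poisson_phiU_phiS_rprime` is the symplectic form `{φ₀^u, φ₀^s} = 2c` of the same fact); `∂_ξφ₀^{u/s} = 1`
(`hasDerivAt_phiU_xi`, `hasDerivAt_phiS_xi`: "`φ₀^{u/s}` is a defining function in `Γ̃₀ × T*(r₊,∞)`", l.4698).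
§7 WORKED EXAMPLE (v2; computed here): SCHWARZSCHILD `a = 0` — `Ψ(3𝔪; σ, η_ϕ) ≡ 0` (`Psi_schwarzschild_photon_sphere`), so every
radius chart at `r₀ = 3𝔪` is the CONSTANT `ρ ≡ 3𝔪` (`radiusChart_schwarzschild`); on `Γ̃₀ ∩ Σ⁺` the energy function is GLOBAL and in
closed form, **`σ = √(η_θ² + η_ϕ²/sin²θ)/(3√3𝔪)`** (`schwarzschild_energy`, from module 76 `schwarzschild_photon_sphere`: `r = 3𝔪`,
`𝒞 = 27𝔪²σ²`), and conversely every momentum datum `(sin²θ; η_θ, η_ϕ) ≠ 0` with this energy lies in `Γ̃₀` with `r' = 3𝔪`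
(`schwarzschild_mem_tildeGamma0`) — [AF] l.4879 "on Schwarzschild, this is the set `{|η|_{g̸⁻¹} = 3√3𝔪}`" / Dyatlov Prop. 3.8
`G_θ = 27M²τ²`, read as the graph of the energy over `T*𝕊² ∖ 0`.

Deviations from print (said once): [AF] proves smoothness of `r'` from the embedding `[Π] : [Γ₀] → S*(ℝ_𝔱 × 𝕊²)/ℝ_𝔱`; the kernel
runs the same two ingredients — (4.44)'s `∂_rΨ ≠ 0` (immersion) and (4.43)'s compactness with (4.46)'s uniqueness (injectivity) — as
the implicit function theorem for the scalar equation `Ψ(r; σ, η_ϕ) = 0` plus a tube-lemma continuity argument, which gives the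
printed conclusion in coordinates (and real-analyticity).  Manifold structures, `S*𝓜/ℝ_𝔱`, and "codimension" are not formalised as
such: "codimension 1" appears as one regular equation `F = 0` with `∂_σF ≠ 0` solved by the analytic graph `σ = S(x)`, "codimension
3" as the graph `(ξ, σ, r) = (0, S, ρ∘S)`, "immersion" as `ker_dPi_trivial`, "transversally" as `transversal_at_rprime`; the charts
are local (balls and windows from the implicit function theorem), globalised along `Γ̃₀` only for the radius (§4).  The coordinates `t, ϕ` are dropped throughout (nothing depends on them) and `θ` enters through `sin²θ`
(BL chart) or `ω` (polar chart).  `σ > 0` is [AF]'s normalisation-free future half (module 76 `InSigmaPlus`).  NOT formalised: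
flows, the invariance of `Γ₀^{u/s}` as sets under the flow (module 81 has its infinitesimal form), Def. 4.17's EXTENSION of (4.47)
off `Γ̃₀ × T*(r₊,∞)` to `S¹_hom(T*𝓜 ∖ o)` (a cut-off construction), (4.48) as a definition, Prop. 4.19, Lemma 4.20, anything of H
§6/§8 or of perturbed metrics.
|a|-census (ADEP.md §D.25): §§1, 2, 3, 5, 6 hold for every real `a` given `μ > 0` at the radius concerned (§3's `∂_rΨ > 0` for
`a² ≤ 𝔪²`, extremality INCLUDED); §4's global statements use `|a| < 𝔪` exactly as (4.43) does — through the photon shell of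
modules 76/78, whose lower margin `s²/(3𝔪)` above `r₊` closes as `|a| → 𝔪`; no smallness of `|a|/𝔪` anywhere.  Engines (cell
`pub-kerr`, `code/adep1-g26/`): A = sympy 1.14 + mpmath (55 checks, PASS: the scaling laws of §1 incl. `ν²`-invariance and the
`t < 0` swap, the three partials of `Ψ` and Euler, the chain rules `hasDerivAt_Psi_comp` / `hasDerivAt_Vfn_comp` on symbolic curves,
the (4.44) rows `∂_rG_3b|_{ξ=0} = −Ψ/μ²`, `∂_σG_3b = −2ϱ²g⁻¹(d𝔱,·)` in both charts and `∂_σF` for an arbitrary `ρ'`, the `ker DΠ`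
minor and the transversality determinant; at 40 digits on the trapped fibre `𝔪 = 1, a = 3/5, r' = 3`: `∂_rΨ > 0`, the implicit
partials `−Ψ_σ/Ψ_r = −1/6`, `−Ψ_η/Ψ_r = −5/36` against finite differences of the continued root, `σ∂_σr' + η∂_ηr' = 0`, `r'(tζ) =
r'(ζ)`, (4.38) on perturbed fibres, and the second implicit-function step — the 2-D continuation `(r, σ)(η_ϕ)` on `{Ψ = 0, G_3b = 0}`
with `dS/dη_ϕ = −F_η/F_σ`, `r = ρ(S, η_ϕ)`, `S(2η) = 2S(η)`; §7's Schwarzschild identities), B = standard library only (seed 2626; 7017 checks, 0 fails: every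
polynomial / rational identity at 250 random rational points EXACTLY, the partials by exact finite-difference stencils (7-point in `r`,
central in `σ, η_ϕ`, 9-point along linear curves), `∂_σG_3b = −2ϱ²g⁻¹(d𝔱,·)` in both charts; 60 EXACT trapped fibres of subextremal
Kerr (Pythagorean `(𝔪, s, a)`, rational `r'`, `η_ϕ` from (4.35), `C = A²/μ`) with `Ψ(r') = Φ⁰(r') = 0`, dilation invariance and
(4.36) exactly, and in 50-digit decimals 309 continuation checks: bisection-continued `r'(σ, η_ϕ)` vs `−Ψ_σ/Ψ_r`, `−Ψ_η/Ψ_r`, the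
vanishing dilation derivative, the level-set derivative `−2ϱ²g⁻¹(d𝔱,ζ)` at admissible angles, and the energy graph `S` by nested
bisection with `dS/dη_ϕ = −F_η/F_σ`; and §7's Schwarzschild identities exactly at 200 random rational points).
[cite: Hintz2026WavesII, §4.2.3 'Trapping II' TeX l.4604-4682 and 'Trapping III' l.4686-4698: Def. 4.13 `DefTs3bOTrap0` l.4607-4613 with l.4615, (4.43) `EqTs3bOTrap0Cpt` l.4615-4619, Lemma 4.14 `LemmaTs3bOTrap0Reg` l.4621-4638 with (4.44) `EqTs3bOTrap0RegDiff` l.4627-4635, (4.45) `EqTs3bOTrapProj` l.4640-4644, (4.46) `EqTs3bOTrapwtGamma0` l.4645-4650 ('which is then necessarily unique'), Def. 4.15 `DefTs3bOTrapus0` l.4652-4660, l.4662-4666 ('Γ₀ = Γ₀^u ∩ Γ₀^s', invariance), Lemma 4.16 `LemmaTs3bOTrapwtGamma` l.4668-4675 (items (1)/(2) l.4672/l.4673) and its proof l.4676-4682 (l.4677 'T_ϖΓ₀ ∩ ker D_ϖΠ = {0}'; l.4679 'compact by (4.43)', 'injective … therefore, it is an embedding', 'the smoothness of the inverse … gives the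 smoothness of r′', 'The homogeneity in ζ is clear'; l.4681 'non-degenerate maximum'); 'Trapping III' l.4686, Def. 4.17 / (4.47) `DefTs3bODefFn` l.4688-4696 and l.4698 ('homogeneous of degree 2 since V, 𝒞 are', 'φ₀^{u/s} is a defining function') (v1 PDF pp.124-125, printed pp.88-89; claims of an unrefereed preprint, reproduced here); Hintz2026WavesII, Prop. 6.3 `PropDyTr` TeX l.5788-5799 and §9.1.2 l.7888-7896 (where the defining functions are consumed); Hintz2026, Prop. 8.3 `PropWETr` TeX l.7395-7403 (the import site); Dyatlov2015, §3.2 Prop. 3.3 (held arXiv text Prop. 2.3 p.16: 'K̃ … is a smooth codimension 2 submanifold of {p̃ = 0} ∖ 0, and its projection K̂ onto the x̂ = (t,θ,φ), ξ̂ = (τ,ξ_θ,ξ_φ) variables is a smooth codimension 1 submanifold of T*(ℝ × 𝕊²)', proof 'the matrix of partial derivatives G, ξ_r, ∂_rG in the variables (r, ξ_r, *) … is invertible') and Prop. 3.5 (held Prop. 2.5 p.17: 'r′ is the only solution to the equation Φ(r) = 0', 'conic smooth codimension 1 submanifolds … intersecting transversely')]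
-/

open Matrix Filter Topology Set Metric Function
open scoped ContDiff

noncomputable section

namespace Literature.Geometry.Lorentzian.Hintz2026.KerrTrappedSetRegularity

open Literature.Geometry.Lorentzian.Hintz2026.KerrDualMetricForm
open Literature.Geometry.Lorentzian.Hintz2026.CarterTetradFrame
open Literature.Geometry.Lorentzian.Hintz2026.KerrTrappedSet
open Literature.Geometry.Lorentzian.Hintz2026.KerrTrappedSetDynamics
open Literature.Geometry.Lorentzian.Hintz2026.KerrTrappingPhasePortrait
open Literature.Analysis.Calculus

/-! ## 1. The conic structure: scaling laws of the printed functions under fibre dilations `ζ ↦ tζ` -/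

section Conic

variable (m a r s2 σ ξ ηθ ηφ C t ω₁ ω₂ η₁ η₂ r' : ℝ)

/-- `A(tζ) = tA(ζ)` ((4.30): `A = −(r²+a²)σ + aη_ϕ` is linear in `ζ`).
[cite: Hintz2026WavesII, eq. (4.30) `EqTs3bOAB` TeX l.4463 and Lemma 4.16(1) 'dilations in ζ' l.4672 (scaling computed here)] -/
theorem Afn_smul : Afn a r (t * σ) (t * ηφ) = t * Afn a r σ ηφ := by
  unfold Afn; ring

/-- `B(tζ) = tB(ζ)` ((4.30)). [cite: Hintz2026WavesII, eq. (4.30) `EqTs3bOAB` TeX l.4464 (scaling computed here)] -/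
theorem Bfn_smul : Bfn a s2 (t * σ) (t * ηφ) = t * Bfn a s2 σ ηφ := by
  unfold Bfn; ring

/-- `V(tζ) = t²V(ζ)` — "`Φ⁰_{(z,ζ)}` is homogeneous of degree 2 since `V, 𝒞` are" (l.4698).
[cite: Hintz2026WavesII, TeX l.4698 ('homogeneous of degree 2 since V, 𝒞 are'; reproduced)] -/
theorem Vfn_smul : Vfn m a r (t * σ) (t * ηφ) = t ^ 2 * Vfn m a r σ ηφ := by
  unfold Vfn; rw [Afn_smul]; ring

/-- `Ψ(r; tζ) = t²Ψ(r; ζ)` ((4.31): `Ψ = −A(4rμσ + Aμ')` is a quadratic form in `(σ, η_ϕ)`).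
[cite: Hintz2026WavesII, eq. (4.31) `EqTs3bOPsi` TeX l.4471 with l.4698 (scaling computed here)] -/
theorem Psi_smul : Psi m a r (t * σ) (t * ηφ) = t ^ 2 * Psi m a r σ ηφ := by
  unfold Psi; rw [Afn_smul]; ring

/-- `𝒞(tζ) = t²𝒞(ζ)` (Boyer–Lindquist chart, module 67 `carterC = η_θ² + sin⁻²θ B²`).
[cite: Hintz2026WavesII, TeX l.4698 ('V, 𝒞 are' homogeneous of degree 2; reproduced)] -/
theorem carterC_smul : carterC a s2 (t * σ) (t * ηθ) (t * ηφ) = t ^ 2 * carterC a s2 σ ηθ ηφ := by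
  unfold carterC; ring

/-- `𝒞(tζ) = t²𝒞(ζ)` in the polar chart (4.22) of module 78 (a polynomial, poles included).
[cite: Hintz2026WavesII, eq. (4.22) `EqTs3bHCarter` TeX l.4361 with l.4698 (scaling computed here)] -/
theorem carterCpol_smul : carterCpol a ω₁ ω₂ (t * σ) (t * η₁) (t * η₂) = t ^ 2 * carterCpol a ω₁ ω₂ σ η₁ η₂ := by
  unfold carterCpol; ring

/-- `η_ϕ = ω¹η₂ − ω²η₁` is linear in `η`. [cite: Hintz2026WavesII, eq. (4.21) `EqTs3bHCoordCart` TeX l.4353 (scaling computed here)] -/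
theorem Lpol_smul : Lpol ω₁ ω₂ (t * η₁) (t * η₂) = t * Lpol ω₁ ω₂ η₁ η₂ := by
  unfold Lpol; ring

/-- `𝒢(r; tξ, tζ) = t²𝒢(r; ξ, ζ)` ((4.32)). [cite: Hintz2026WavesII, eq. (4.32) `EqTs3bOMetHam` TeX l.4477-4478 (scaling computed here)] -/
theorem sG_smul : sG m a r (t * σ) (t * ξ) (t * ηφ) = t ^ 2 * sG m a r σ ξ ηφ := by
  unfold sG; rw [Vfn_smul]; ring

/-- `G_3b(r, z; tξ, tζ) = t²G_3b(r, z; ξ, ζ)` — the dual metric function is a quadratic form in the covector, so `Σ = {G_3b = 0}` is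
conic. [cite: Hintz2026WavesII, eq. (4.32) `EqTs3bOMetHam` TeX l.4477-4478 and Lemma 4.14 ('smooth conic … submanifold', l.4623; scaling computed here)] -/
theorem G3b_smul : G3b m a r s2 (t * σ) (t * ξ) (t * ηθ) (t * ηφ) = t ^ 2 * G3b m a r s2 σ ξ ηθ ηφ := by
  unfold G3b; rw [sG_smul, carterC_smul]; ring

/-- The same in the polar chart. [cite: Hintz2026WavesII, eq. (4.32) with (4.22) TeX l.4477-4478, l.4361 (scaling computed here)] -/
theorem G3bpol_smul :
    G3bpol m a r ω₁ ω₂ (t * σ) (t * ξ) (t * η₁) (t * η₂) = t ^ 2 * G3bpol m a r ω₁ ω₂ σ ξ η₁ η₂ := by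
  unfold G3bpol; rw [Lpol_smul, sG_smul, carterCpol_smul]; ring

/-- `ϱ²g⁻¹(d𝔱, tζ) = t·ϱ²g⁻¹(d𝔱, ζ)` ((4.41) is linear in `ζ`), so the future half `Σ⁺` is invariant under POSITIVE dilations.
[cite: Hintz2026WavesII, eq. (4.41) `EqTs3bOTrapSign` TeX l.4596 (scaling computed here)] -/
theorem dtPairing_smul : dtPairing m a r s2 (t * σ) (t * ηφ) = t * dtPairing m a r s2 σ ηφ := by
  unfold dtPairing; rw [Afn_smul, Bfn_smul]; ring

/-- `Φ⁰` ((4.34)) is homogeneous of degree 2 in `(ζ, C) ↦ (tζ, t²C)` (the Carter VALUE scales like `𝒞`).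
[cite: Hintz2026WavesII, eq. (4.34) `EqTs3bOG0` TeX l.4520-4524 with l.4698 ('Φ⁰ is homogeneous of degree 2'; reproduced)] -/
theorem Phi0_smul : Phi0 m a (t * σ) (t * ηφ) (t ^ 2 * C) r = t ^ 2 * Phi0 m a σ ηφ C r := by
  unfold Phi0; rw [Vfn_smul]; ring

/-- `𝒢⁰` ((4.34)) is homogeneous of degree 2. [cite: Hintz2026WavesII, eq. (4.34) `EqTs3bOG0` TeX l.4520-4524 (scaling computed here)] -/
theorem sG0_smul : sG0 m a (t * σ) (t * ηφ) (t ^ 2 * C) r (t * ξ) = t ^ 2 * sG0 m a σ ηφ C r ξ := by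
  unfold sG0; rw [Phi0_smul]; ring

/-- `∂_rΦ⁰ = −Ψ/μ²` is homogeneous of degree 2. [cite: Hintz2026WavesII, proof of Lemma 4.12 TeX l.4544 (scaling computed here)] -/
theorem dPhi0_smul : dPhi0 m a (t * σ) (t * ηφ) r = t ^ 2 * dPhi0 m a σ ηφ r := by
  unfold dPhi0; rw [Psi_smul]; ring

/-- `∂_rΨ` ((4.36), module 76's formal derivative) is homogeneous of degree 2.
[cite: Hintz2026WavesII, eq. (4.36) `EqTs3bOConvPsi` TeX l.4553 (scaling computed here)] -/
theorem dPsiFormal_smul :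
    dPsiFormal m a r (t * σ) (Afn a r (t * σ) (t * ηφ)) = t ^ 2 * dPsiFormal m a r σ (Afn a r σ ηφ) := by
  rw [Afn_smul]; unfold dPsiFormal; ring

/-- `∂_r²Φ` (module 78 `d2Phi`) is homogeneous of degree 2. [cite: Hintz2026WavesII, proof of Lemma 4.12 TeX l.4549 (scaling computed here)] -/
theorem d2Phi_smul : d2Phi m a r (t * σ) (t * ηφ) = t ^ 2 * d2Phi m a r σ ηφ := by
  unfold d2Phi; rw [dPsiFormal_smul, Psi_smul]; ring

/-- **`ν²` (4.49) is INVARIANT under dilations** (`ν = σ⁻¹√(−2μ∂_r²Φ⁰)`: numerator and `σ²` both scale by `t²`) — the expansion rate is a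
function on the quotient `S*𝓜/ℝ_𝔱` where [AF] works (l.4679). [cite: Hintz2026WavesII, eq. (4.49) `EqTs3bOnuExpr` TeX l.4708-4711 and proof of Lemma 4.16 l.4679 ('Passing to quotients by fiber-dilations'; invariance computed here)] -/
theorem nuSq_smul (ht : t ≠ 0) : nuSq m a r (t * σ) (t * ηφ) = nuSq m a r σ ηφ := by
  unfold nuSq; rw [d2Phi_smul]
  by_cases hσ : σ = 0
  · simp [hσ]
  · have ht2 : t ^ 2 ≠ 0 := pow_ne_zero 2 ht
    field_simp

/-- **Def. 4.13's triple `(ξ, Ψ, G_3b) = 0` is dilation invariant** (`t ≠ 0`): `Γ₀` is conic (Boyer–Lindquist chart).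
[cite: Hintz2026WavesII, Lemma 4.14 `LemmaTs3bOTrap0Reg` TeX l.4623 ('Γ₀ is a smooth conic … submanifold') and l.4626 ('The conic set Γ₀'; reproduced)] -/
theorem onGamma0_smul_iff (ht : t ≠ 0) :
    OnGamma0 m a r s2 (t * σ) (t * ξ) (t * ηθ) (t * ηφ) ↔ OnGamma0 m a r s2 σ ξ ηθ ηφ := by
  unfold OnGamma0
  rw [Psi_smul, G3b_smul]
  have ht2 : t ^ 2 ≠ 0 := pow_ne_zero 2 ht
  simp [ht, ht2]

/-- The same in the polar chart (poles included). [cite: Hintz2026WavesII, Lemma 4.14 TeX l.4623, l.4626 with (4.21)-(4.22) l.4346-4361 (reproduced)] -/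
theorem onGamma0Pol_smul_iff (ht : t ≠ 0) :
    OnGamma0Pol m a r ω₁ ω₂ (t * σ) (t * ξ) (t * η₁) (t * η₂) ↔ OnGamma0Pol m a r ω₁ ω₂ σ ξ η₁ η₂ := by
  unfold OnGamma0Pol
  rw [Lpol_smul, Psi_smul, G3bpol_smul]
  have ht2 : t ^ 2 ≠ 0 := pow_ne_zero 2 ht
  simp [ht, ht2]

/-- The future half `Σ⁺` (module 76 `InSigmaPlus`: `ϱ²g⁻¹(d𝔱, ζ) > 0`) is invariant under positive dilations.
[cite: Hintz2026WavesII, eq. (4.11b) `EqTsChar2` TeX l.4189-4195 and Lemma 4.16(1) l.4672 (reproduced)] -/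
theorem inSigmaPlus_smul_iff (ht : 0 < t) : InSigmaPlus m a r s2 (t * σ) (t * ηφ) ↔ InSigmaPlus m a r s2 σ ηφ := by
  unfold InSigmaPlus; rw [dtPairing_smul]; exact mul_pos_iff_of_pos_left ht

/-- The double-zero condition (4.37) `Φ⁰(r') = 0, Ψ(r') = 0` is dilation invariant (`t ≠ 0`).
[cite: Hintz2026WavesII, eq. (4.37) `EqTs3bOPhiDouble` TeX l.4561-4564 with Lemma 4.16(1) l.4672 (reproduced)] -/
theorem trapped_fibre_smul_iff (ht : t ≠ 0) :
    (Phi0 m a (t * σ) (t * ηφ) (t ^ 2 * C) r' = 0 ∧ Psi m a r' (t * σ) (t * ηφ) = 0) ↔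
      (Phi0 m a σ ηφ C r' = 0 ∧ Psi m a r' σ ηφ = 0) := by
  rw [Phi0_smul, Psi_smul]
  have ht2 : t ^ 2 ≠ 0 := pow_ne_zero 2 ht
  simp [ht2]

variable {m a σ ηφ C t r'}

/-- **Lemma 4.16(1), "homogeneous of degree 0 with respect to dilations in `ζ`"**: the dilated fibre `(tζ, t²C)` (`t ≠ 0`) has the
SAME unique trapped radius `r'` — any zero `ρ > r₊` of its potential is `r'` (module 81 `trapped_radius_unique`; `a² = 𝔪² − s²`,
`s ≥ 0`, `C > 0`). [cite: Hintz2026WavesII, Lemma 4.16(1) `LemmaTs3bOTrapwtGamma` TeX l.4672 and proof l.4679 ('The homogeneity in ζ is clear'; reproduced)] -/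
theorem trapped_radius_smul {s : ℝ} (hm : 0 ≤ m) (hs : 0 ≤ s) (has : s ^ 2 + a ^ 2 = m ^ 2) (hC : 0 < C)
    (hr' : m + s < r') (h0 : Phi0 m a σ ηφ C r' = 0) (h1 : Psi m a r' σ ηφ = 0) (ht : t ≠ 0)
    {ρ : ℝ} (hρ : m + s < ρ) (hΦ : Phi0 m a (t * σ) (t * ηφ) (t ^ 2 * C) ρ = 0) : ρ = r' := by
  rw [Phi0_smul] at hΦ
  have ht2 : t ^ 2 ≠ 0 := pow_ne_zero 2 ht
  rcases mul_eq_zero.mp hΦ with h | h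
  · exact absurd h ht2
  · exact trapped_radius_unique hm hs has hC hr' h0 h1 hρ h

variable (m a σ ηφ C t r')

/-- (4.47): `u = −Φ⁰/μ` scales by `t²`. [cite: Hintz2026WavesII, eq. (4.47) `EqTs3bODefFn` TeX l.4691-4694 with l.4698 (scaling computed here)] -/
theorem uFn_smul : uFn m a (t * σ) (t * ηφ) (t ^ 2 * C) r = t ^ 2 * uFn m a σ ηφ C r := by
  unfold uFn; rw [Phi0_smul]; ring

/-- (4.47): the branch `sgn(r − r')√(−Φ⁰/μ)` scales by `|t|` (`r'` being unchanged).
[cite: Hintz2026WavesII, eq. (4.47) `EqTs3bODefFn` TeX l.4691-4694 with l.4698 (scaling computed here)] -/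
theorem brU_smul : brU m a (t * σ) (t * ηφ) (t ^ 2 * C) r' r = |t| * brU m a σ ηφ C r' r := by
  unfold brU; rw [uFn_smul, Real.sqrt_mul (sq_nonneg t), Real.sqrt_sq_eq_abs]; ring

/-- **"so (4.47) is homogeneous of degree 1"**: `φ₀^u(r, z; tξ, tζ) = tφ₀^u(r, z; ξ, ζ)` for `t > 0`.
[cite: Hintz2026WavesII, Def. 4.17 / (4.47) `DefTs3bODefFn` TeX l.4688-4696 and l.4698 ('homogeneous of degree 1'; reproduced)] -/
theorem phiU_smul (ht : 0 < t) :
    phiU m a (t * σ) (t * ηφ) (t ^ 2 * C) r' r (t * ξ) = t * phiU m a σ ηφ C r' r ξ := by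
  unfold phiU; rw [brU_smul, abs_of_pos ht]; ring

/-- `φ₀^s(r, z; tξ, tζ) = tφ₀^s(r, z; ξ, ζ)` for `t > 0`. [cite: Hintz2026WavesII, Def. 4.17 / (4.47) TeX l.4688-4698 (reproduced)] -/
theorem phiS_smul (ht : 0 < t) :
    phiS m a (t * σ) (t * ηφ) (t ^ 2 * C) r' r (t * ξ) = t * phiS m a σ ηφ C r' r ξ := by
  unfold phiS; rw [brU_smul, abs_of_pos ht]; ring

/-- A NEGATIVE dilation (the reflection `ζ ↦ tζ`, `t < 0`, which maps `Σ⁺` to `Σ⁻`) SWAPS the two functions: `φ₀^u(tξ, tζ) =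
tφ₀^s(ξ, ζ)` — time reversal exchanges the stable and unstable branches (computed here; [AF] works on `Σ⁺` only).
[cite: Hintz2026WavesII, Def. 4.17 / (4.47) TeX l.4688-4698 and (4.40) l.4580-4586 ('future, resp. past directed'; the reflection property computed here)] -/
theorem phiU_smul_of_neg (ht : t < 0) :
    phiU m a (t * σ) (t * ηφ) (t ^ 2 * C) r' r (t * ξ) = t * phiS m a σ ηφ C r' r ξ := by
  unfold phiU phiS; rw [brU_smul, abs_of_neg ht]; ring

/-- … and `φ₀^s(tξ, tζ) = tφ₀^u(ξ, ζ)` for `t < 0`. [cite: Hintz2026WavesII, Def. 4.17 / (4.47) TeX l.4688-4698 (reflection property computed here)] -/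
theorem phiS_smul_of_neg (ht : t < 0) :
    phiS m a (t * σ) (t * ηφ) (t ^ 2 * C) r' r (t * ξ) = t * phiU m a σ ηφ C r' r ξ := by
  unfold phiU phiS; rw [brU_smul, abs_of_neg ht]; ring

/-- `∂_{η_ϕ}Ψ = −(a(4rμσ + Aμ') + A·aμ')` (`∂_{η_ϕ}A = a`; not displayed in [AF]).
[cite: Hintz2026WavesII, eq. (4.31) `EqTs3bOPsi` TeX l.4471 (partial derivative computed here)] -/
def dPsi_detaphi (m a r σ ηφ : ℝ) : ℝ :=
  -(a * (4 * r * mu m a r * σ + Afn a r σ ηφ * dmu m r) + Afn a r σ ηφ * (a * dmu m r))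

/-- `∂_{η_ϕ}Ψ` certified. [cite: Hintz2026WavesII, eq. (4.31) `EqTs3bOPsi` TeX l.4471 (computed here)] -/
theorem hasDerivAt_Psi_etaphi : HasDerivAt (fun x => Psi m a r σ x) (dPsi_detaphi m a r σ ηφ) ηφ := by
  unfold Psi
  exact (((hasDerivAt_Afn_etaphi a r σ ηφ).fun_mul (((hasDerivAt_const ηφ (4 * r * mu m a r * σ))).fun_add
    ((hasDerivAt_Afn_etaphi a r σ ηφ).fun_mul (hasDerivAt_const ηφ (dmu m r))))).fun_neg).congr_deriv
    (by unfold dPsi_detaphi; ring)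

/-- **Euler's relation for the degree-2 homogeneous `Ψ`: `σ∂_σΨ + η_ϕ∂_{η_ϕ}Ψ = 2Ψ`** (module 76's `∂_σΨ` and the `∂_{η_ϕ}Ψ` above) —
so at a zero of `Ψ` the fibre-differential of `Ψ` annihilates the dilation generator `σ∂_σ + η_ϕ∂_{η_ϕ}`.
[cite: Hintz2026WavesII, Lemma 4.16(1) TeX l.4672 ('homogeneous of degree 0 with respect to dilations in ζ') with (4.31) l.4471 (Euler identity computed here)] -/
theorem euler_Psi : σ * dPsi_dsigma m a r σ ηφ + ηφ * dPsi_detaphi m a r σ ηφ = 2 * Psi m a r σ ηφ := by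
  unfold dPsi_dsigma dPsi_detaphi Psi Afn; ring

end Conic

/-! ## 2. [AF] (4.44)–(4.45): `ker D_ϖΠ ∩ T_ϖΓ₀ = {0}` — "`Π|_{Γ₀}` is an immersion" -/

section Immersion

variable (m a r s2 σ ξ ηφ : ℝ)

/-- **The first claim of the proof of Lemma 4.16**: "given `v = a∂_r + b∂_ξ ∈ ker D_ϖΠ`, we get `0 = dξ(v) = b`, so `b = 0`, and then
`dΨ(v) = a∂_rΨ = 0` forces `a = 0` by (4.44)".  With module 76's Jacobian `jac` (rows `dξ, dΨ, dG_3b`; columns `∂_ξ, ∂_r, ∂_σ`) and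
`v = (β, α, 0)` (no `∂_σ`-component: `v ∈ ker DΠ`): rows `0` and `1` of `jac·v` vanish ⇒ `α = β = 0`, provided `∂_rΨ ≠ 0`.
[cite: Hintz2026WavesII, proof of Lemma 4.16 TeX l.4677 ('T_ϖΓ₀ ∩ ker D_ϖΠ = {0}' … 'forces a = 0 by (4.44)') with (4.44) `EqTs3bOTrap0RegDiff` l.4627-4635 and (4.45) `EqTs3bOTrapProj` l.4640-4644 (reproduced)] -/
theorem ker_dPi_trivial (hd : dPsiFormal m a r σ (Afn a r σ ηφ) ≠ 0) {α β : ℝ}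
    (hξ : (jac m a r s2 σ ξ ηφ).mulVec ![β, α, 0] 0 = 0) (hΨ : (jac m a r s2 σ ξ ηφ).mulVec ![β, α, 0] 1 = 0) :
    α = 0 ∧ β = 0 := by
  simp [jac, Matrix.mulVec, dotProduct, Fin.sum_univ_three] at hξ hΨ
  rcases hΨ with h | h
  · exact absurd h hd
  · exact ⟨h, hξ⟩

end Immersion

/-! ## 3. Lemma 4.16(1), local form: the trapped radius as a real-analytic implicit function of `(σ, η_ϕ)` -/

section ImplicitRadius

variable (m a : ℝ)

/-- `Ψ` is a polynomial in `(r; σ, η_ϕ)`, hence of class `C^ω` (indeed `Cⁿ` for every `n`) jointly — the regularity input of the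
implicit function theorem. [cite: Hintz2026WavesII, eq. (4.31) `EqTs3bOPsi` TeX l.4471 (a polynomial; regularity recorded here)] -/
theorem contDiff_Psi {n : WithTop ℕ∞} :
    ContDiff ℝ n (fun q : (ℝ × ℝ) × ℝ => Psi m a q.2 q.1.1 q.1.2) := by
  unfold Psi Afn mu dmu
  fun_prop

/-- `deriv_r Ψ = ∂_rΨ` (module 76's certified (4.36)). [cite: Hintz2026WavesII, eq. (4.36) `EqTs3bOConvPsi` TeX l.4553 (reproduced: module 76 `hasDerivAt_Psi`)] -/
theorem deriv_Psi_r (r σ ηφ : ℝ) : deriv (fun ρ => Psi m a ρ σ ηφ) r = dPsiFormal m a r σ (Afn a r σ ηφ) :=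
  (hasDerivAt_Psi m a r σ ηφ).deriv

/-- **A RADIUS CHART at `(σ₀, η₀; r₀)`** — the data produced by the implicit function theorem for `Ψ(r; σ, η_ϕ) = 0` at a simple
root: radii `ε, δ > 0` and a function `ρ` of the conserved fibre data `(σ, η_ϕ)`, real-analytic on the ball `B((σ₀,η₀), ε)`, with
`ρ(σ₀, η₀) = r₀`, values in the window `(r₀ − δ, r₀ + δ)`, `Ψ(ρ(σ,η); σ, η) = 0`, and `ρ(σ, η)` the ONLY root of `Ψ(·; σ, η)` in the
window.  (This is `r'_{(z,ζ)}` of (4.46) / Def. 4.15 as a function, locally: see `eventually_radius_eq_chart`.)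
[cite: Hintz2026WavesII, Lemma 4.16(1) `LemmaTs3bOTrapwtGamma` TeX l.4672 ('The map Γ̃₀ ∋ (z,ζ) ↦ r′_{(z,ζ)} ∈ (r₊,∞) is smooth') and its proof l.4677-4679 (packaging of the implicit-function data; transcription of the conclusion in coordinates)] -/
structure RadiusChart (m a σ₀ η₀ r₀ : ℝ) where
  /-- radius of the ball of fibre data `(σ, η_ϕ)` -/
  ε : ℝ
  /-- half-width of the radial uniqueness window -/
  δ : ℝ
  /-- the implicit function `(σ, η_ϕ) ↦ r'` -/
  ρ : ℝ × ℝ → ℝ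
  ε_pos : 0 < ε
  δ_pos : 0 < δ
  smooth : ContDiffOn ℝ ω ρ (ball (σ₀, η₀) ε)
  center : ρ (σ₀, η₀) = r₀
  window : ∀ p ∈ ball (σ₀, η₀) ε, ρ p ∈ Ioo (r₀ - δ) (r₀ + δ)
  root : ∀ p ∈ ball (σ₀, η₀) ε, Psi m a (ρ p) p.1 p.2 = 0
  unique : ∀ p ∈ ball (σ₀, η₀) ε, ∀ r ∈ Ioo (r₀ - δ) (r₀ + δ), Psi m a r p.1 p.2 = 0 → r = ρ p

variable {m a}
variable {σ₀ η₀ r₀ : ℝ}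

/-- The implicit function theorem at a SIMPLE root of `Ψ(·; σ₀, η₀)`: a radius chart exists whenever `Ψ(r₀; σ₀, η₀) = 0` and
`∂_rΨ(r₀) ≠ 0` (the tree's `exists_contDiffOn_crossingTime` with parameter space `ℝ²` and `n = ω`).
[cite: Hintz2026WavesII, proof of Lemma 4.16 TeX l.4677-4679 ('dΨ(v) = a∂_rΨ = 0 forces a = 0 by (4.44)' ⇒ immersion ⇒ 'the smoothness of r′'; reproduced via the implicit function theorem)] -/
theorem nonempty_radiusChart_of_dPsi_ne_zero (hΨ : Psi m a r₀ σ₀ η₀ = 0)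
    (hd : dPsiFormal m a r₀ σ₀ (Afn a r₀ σ₀ η₀) ≠ 0) : Nonempty (RadiusChart m a σ₀ η₀ r₀) := by
  have hg : ContDiffAt ℝ ω (uncurry fun (p : ℝ × ℝ) (r : ℝ) => Psi m a r p.1 p.2) ((σ₀, η₀), r₀) :=
    (contDiff_Psi m a).contDiffAt
  have hspeed : deriv ((fun (p : ℝ × ℝ) (r : ℝ) => Psi m a r p.1 p.2) (σ₀, η₀)) r₀ ≠ 0 := by
    show deriv (fun r => Psi m a r σ₀ η₀) r₀ ≠ 0
    rw [deriv_Psi_r]; exact hd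
  obtain ⟨ε, hε, δ, hδ, ρ, hρ, h0, h1, h2⟩ :=
    exists_contDiffOn_crossingTime (X := ℝ × ℝ) (n := ω) (by simp) (by simp) hg hspeed
  refine ⟨⟨ε, δ, ρ, hε, hδ, hρ, h0, fun p hp => (h1 p hp).1, fun p hp => ?_, fun p hp r hr h => h2 p hp r hr ?_⟩⟩
  · have h := (h1 p hp).2
    simp only [hΨ] at h
    exact h
  · show Psi m a r p.1 p.2 = Psi m a r₀ σ₀ η₀
    rw [h, hΨ]

/-- **Lemma 4.16(1), LOCAL FORM, at every trapped point and for all `a² ≤ 𝔪²`**: if `Ψ(r₀; σ₀, η₀) = 0`, `A ≠ 0` (off the zero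
section), `r₀ > 𝔪 ≥ 0`, `μ(r₀) > 0`, then `∂_rΨ(r₀) > 0` (module 76 `dPsi_pos` = (4.36), via the trapped relation (4.35)) and a
radius chart exists: the trapped radius is, near `(σ₀, η₀)`, a REAL-ANALYTIC function `ρ(σ, η_ϕ)`.
[cite: Hintz2026WavesII, Lemma 4.16(1) `LemmaTs3bOTrapwtGamma` TeX l.4672 and proof l.4677-4679 with (4.44) l.4631 ('∂_rΨ ≠ 0') and (4.36) l.4555 (reproduced in coordinates)] -/
theorem nonempty_radiusChart (hm : 0 ≤ m) (hmr : m < r₀) (ha : a ^ 2 ≤ m ^ 2) (hμ : 0 < mu m a r₀)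
    (hΨ : Psi m a r₀ σ₀ η₀ = 0) (hA : Afn a r₀ σ₀ η₀ ≠ 0) : Nonempty (RadiusChart m a σ₀ η₀ r₀) :=
  nonempty_radiusChart_of_dPsi_ne_zero hΨ
    (dPsi_pos m a r₀ σ₀ (Afn a r₀ σ₀ η₀) hm hmr ha hμ hA (trapped_relation hΨ hA)).ne'

namespace RadiusChart

variable (Φ : RadiusChart m a σ₀ η₀ r₀)

/-- The base point lies in the chart. [cite: Hintz2026WavesII, proof of Lemma 4.16 TeX l.4677 ('Let (z,ζ) ∈ Γ̃₀'; bookkeeping)] -/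
theorem mem_ball_self : (σ₀, η₀) ∈ ball (σ₀, η₀) Φ.ε := Metric.mem_ball_self Φ.ε_pos

/-- `ρ` is `C^ω` at every point of the ball. [cite: Hintz2026WavesII, Lemma 4.16(1) TeX l.4672 ('is smooth'; reproduced)] -/
theorem contDiffAt {p : ℝ × ℝ} (hp : p ∈ ball (σ₀, η₀) Φ.ε) : ContDiffAt ℝ ω Φ.ρ p :=
  Φ.smooth.contDiffAt (isOpen_ball.mem_nhds hp)

/-- `ρ` is differentiable at every point of the ball. [cite: Hintz2026WavesII, Lemma 4.16(1) TeX l.4672 (reproduced)] -/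
theorem differentiableAt {p : ℝ × ℝ} (hp : p ∈ ball (σ₀, η₀) Φ.ε) : DifferentiableAt ℝ Φ.ρ p :=
  (Φ.contDiffAt hp).differentiableAt (by simp)

/-- **"homogeneous of degree 0 with respect to dilations in `ζ`"** for the smooth function: `ρ(tσ, tη) = ρ(σ, η)` whenever both data
lie in the chart — since `Ψ(ρ(σ,η); tσ, tη) = t²·0 = 0` and `ρ(σ, η)` lies in the uniqueness window.
[cite: Hintz2026WavesII, Lemma 4.16(1) `LemmaTs3bOTrapwtGamma` TeX l.4672 and proof l.4679 ('The homogeneity in ζ is clear'; reproduced)] -/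
theorem smul_eq {p : ℝ × ℝ} {t : ℝ} (hp : p ∈ ball (σ₀, η₀) Φ.ε) (htp : (t * p.1, t * p.2) ∈ ball (σ₀, η₀) Φ.ε) :
    Φ.ρ (t * p.1, t * p.2) = Φ.ρ p := by
  have h := Φ.unique (t * p.1, t * p.2) htp (Φ.ρ p) (Φ.window p hp)
    (by show Psi m a (Φ.ρ p) (t * p.1) (t * p.2) = 0; rw [Psi_smul, Φ.root p hp, mul_zero])
  exact h.symm

end RadiusChart

/-- **Total derivative of `Ψ` along a differentiable curve `x ↦ (r, σ, η_ϕ)(x)`**: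
`(Ψ∘γ)' = ∂_rΨ·r' + ∂_σΨ·σ' + ∂_{η_ϕ}Ψ·η'` with the three certified partials (module 76 `dPsiFormal`, `dPsi_dsigma`; `dPsi_detaphi`).
[cite: Hintz2026WavesII, eq. (4.31) `EqTs3bOPsi` TeX l.4471 and (4.44) l.4627-4635 (chain rule on the printed polynomial, computed here)] -/
theorem hasDerivAt_Psi_comp {f g h : ℝ → ℝ} {f' g' h' y : ℝ} (hf : HasDerivAt f f' y) (hg : HasDerivAt g g' y)
    (hh : HasDerivAt h h' y) :
    HasDerivAt (fun x => Psi m a (f x) (g x) (h x))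
      (dPsiFormal m a (f y) (g y) (Afn a (f y) (g y) (h y)) * f' + dPsi_dsigma m a (f y) (g y) (h y) * g'
        + dPsi_detaphi m a (f y) (g y) (h y) * h') y := by
  have hA : HasDerivAt (fun x => Afn a (f x) (g x) (h x))
      (-((2 * f y * f') * g y + (f y ^ 2 + a ^ 2) * g') + a * h') y := by
    unfold Afn
    exact ((((hf.fun_pow 2).fun_add (hasDerivAt_const y (a ^ 2))).fun_mul hg).fun_neg.fun_add
      ((hasDerivAt_const y a).fun_mul hh)).congr_deriv (by ring)
  have hμ : HasDerivAt (fun x => mu m a (f x)) (dmu m (f y) * f') y := (hasDerivAt_mu m a (f y)).comp y hf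
  have hd : HasDerivAt (fun x => dmu m (f x)) (2 * f') y := (hasDerivAt_dmu m (f y)).comp y hf
  unfold Psi
  exact ((hA.fun_mul ((((((hasDerivAt_const y (4 : ℝ)).fun_mul hf).fun_mul hμ).fun_mul hg).fun_add
    (hA.fun_mul hd)))).fun_neg).congr_deriv (by unfold dPsiFormal dPsi_dsigma dPsi_detaphi dmu; ring)

namespace RadiusChart

variable (Φ : RadiusChart m a σ₀ η₀ r₀)

/-- The `σ`-section of the chart is differentiable at `σ₀`, with SOME derivative `d` (named below).
[cite: Hintz2026WavesII, Lemma 4.16(1) TeX l.4672 (reproduced)] -/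
theorem hasDerivAt_sigma_deriv :
    HasDerivAt (fun x => Φ.ρ (x, η₀)) (deriv (fun x => Φ.ρ (x, η₀)) σ₀) σ₀ := by
  have h1 : ContDiffAt ℝ ω Φ.ρ (σ₀, η₀) := Φ.contDiffAt Φ.mem_ball_self
  have h2 : ContDiffAt ℝ ω (fun x : ℝ => (x, η₀)) σ₀ := by fun_prop
  exact ((h1.comp σ₀ h2).differentiableAt (by simp)).hasDerivAt

/-- The `η_ϕ`-section of the chart is differentiable at `η₀`. [cite: Hintz2026WavesII, Lemma 4.16(1) TeX l.4672 (reproduced)] -/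
theorem hasDerivAt_etaphi_deriv :
    HasDerivAt (fun x => Φ.ρ (σ₀, x)) (deriv (fun x => Φ.ρ (σ₀, x)) η₀) η₀ := by
  have h1 : ContDiffAt ℝ ω Φ.ρ (σ₀, η₀) := Φ.contDiffAt Φ.mem_ball_self
  have h2 : ContDiffAt ℝ ω (fun x : ℝ => (σ₀, x)) η₀ := by fun_prop
  exact ((h1.comp η₀ h2).differentiableAt (by simp)).hasDerivAt

/-- Data `(x, η₀)` lie in the chart for `x` near `σ₀`. [cite: Hintz2026WavesII, proof of Lemma 4.16 TeX l.4677 (bookkeeping)] -/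
theorem eventually_mem_ball_sigma : ∀ᶠ x in 𝓝 σ₀, (x, η₀) ∈ ball (σ₀, η₀) Φ.ε := by
  have hc : ContinuousAt (fun x : ℝ => (x, η₀)) σ₀ := by fun_prop
  exact hc.preimage_mem_nhds (isOpen_ball.mem_nhds Φ.mem_ball_self)

/-- Data `(σ₀, x)` lie in the chart for `x` near `η₀`. [cite: Hintz2026WavesII, proof of Lemma 4.16 TeX l.4677 (bookkeeping)] -/
theorem eventually_mem_ball_etaphi : ∀ᶠ x in 𝓝 η₀, (σ₀, x) ∈ ball (σ₀, η₀) Φ.ε := by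
  have hc : ContinuousAt (fun x : ℝ => (σ₀, x)) η₀ := by fun_prop
  exact hc.preimage_mem_nhds (isOpen_ball.mem_nhds Φ.mem_ball_self)

/-- **`∂_σr' = −∂_σΨ/∂_rΨ`** at the base point (`∂_rΨ(r₀) ≠ 0`): differentiate `Ψ(ρ(σ, η₀); σ, η₀) ≡ 0`.
[cite: Hintz2026WavesII, Lemma 4.16(1) TeX l.4672 and (4.44) `EqTs3bOTrap0RegDiff` l.4627-4635 (the implicit derivative, computed here)] -/
theorem hasDerivAt_sigma (hd : dPsiFormal m a r₀ σ₀ (Afn a r₀ σ₀ η₀) ≠ 0) :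
    HasDerivAt (fun x => Φ.ρ (x, η₀)) (-dPsi_dsigma m a r₀ σ₀ η₀ / dPsiFormal m a r₀ σ₀ (Afn a r₀ σ₀ η₀)) σ₀ := by
  have hρ := Φ.hasDerivAt_sigma_deriv
  set d := deriv (fun x => Φ.ρ (x, η₀)) σ₀ with hd_def
  have hcomp := hasDerivAt_Psi_comp (m := m) (a := a) hρ (hasDerivAt_id σ₀) (hasDerivAt_const σ₀ η₀)
  have hzero : (fun x => Psi m a (Φ.ρ (x, η₀)) (id x) η₀) =ᶠ[𝓝 σ₀] fun _ => (0 : ℝ) := by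
    filter_upwards [Φ.eventually_mem_ball_sigma] with x hx
    exact Φ.root (x, η₀) hx
  have h0 : HasDerivAt (fun x => Psi m a (Φ.ρ (x, η₀)) (id x) η₀) 0 σ₀ :=
    (hasDerivAt_const σ₀ (0 : ℝ)).congr_of_eventuallyEq hzero
  have heq := hcomp.unique h0
  simp only [Φ.center, id_eq, mul_one, mul_zero, add_zero] at heq
  have hval : d = -dPsi_dsigma m a r₀ σ₀ η₀ / dPsiFormal m a r₀ σ₀ (Afn a r₀ σ₀ η₀) := by
    field_simp
    linarith
  rw [← hval]; exact hρ

/-- **`∂_{η_ϕ}r' = −∂_{η_ϕ}Ψ/∂_rΨ`** at the base point. [cite: Hintz2026WavesII, Lemma 4.16(1) TeX l.4672 (the implicit derivative, computed here)] -/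
theorem hasDerivAt_etaphi (hd : dPsiFormal m a r₀ σ₀ (Afn a r₀ σ₀ η₀) ≠ 0) :
    HasDerivAt (fun x => Φ.ρ (σ₀, x)) (-dPsi_detaphi m a r₀ σ₀ η₀ / dPsiFormal m a r₀ σ₀ (Afn a r₀ σ₀ η₀)) η₀ := by
  have hρ := Φ.hasDerivAt_etaphi_deriv
  set d := deriv (fun x => Φ.ρ (σ₀, x)) η₀ with hd_def
  have hcomp := hasDerivAt_Psi_comp (m := m) (a := a) hρ (hasDerivAt_const η₀ σ₀) (hasDerivAt_id η₀)
  have hzero : (fun x => Psi m a (Φ.ρ (σ₀, x)) σ₀ (id x)) =ᶠ[𝓝 η₀] fun _ => (0 : ℝ) := by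
    filter_upwards [Φ.eventually_mem_ball_etaphi] with x hx
    exact Φ.root (σ₀, x) hx
  have h0 : HasDerivAt (fun x => Psi m a (Φ.ρ (σ₀, x)) σ₀ (id x)) 0 η₀ :=
    (hasDerivAt_const η₀ (0 : ℝ)).congr_of_eventuallyEq hzero
  have heq := hcomp.unique h0
  simp only [Φ.center, id_eq, mul_one, mul_zero, add_zero] at heq
  have hval : d = -dPsi_detaphi m a r₀ σ₀ η₀ / dPsiFormal m a r₀ σ₀ (Afn a r₀ σ₀ η₀) := by
    field_simp
    linarith
  rw [← hval]; exact hρ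

/-- **`σ∂_σr' + η_ϕ∂_{η_ϕ}r' = 0`** — the dilation derivative of the trapped radius vanishes (Euler: `σ∂_σΨ + η∂_ηΨ = 2Ψ = 0` at the
root), the infinitesimal form of "homogeneous of degree 0".
[cite: Hintz2026WavesII, Lemma 4.16(1) `LemmaTs3bOTrapwtGamma` TeX l.4672 ('homogeneous of degree 0 with respect to dilations in ζ'; infinitesimal form computed here)] -/
theorem dilation_deriv_eq_zero (hd : dPsiFormal m a r₀ σ₀ (Afn a r₀ σ₀ η₀) ≠ 0) (hΨ : Psi m a r₀ σ₀ η₀ = 0) :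
    σ₀ * (-dPsi_dsigma m a r₀ σ₀ η₀ / dPsiFormal m a r₀ σ₀ (Afn a r₀ σ₀ η₀))
      + η₀ * (-dPsi_detaphi m a r₀ σ₀ η₀ / dPsiFormal m a r₀ σ₀ (Afn a r₀ σ₀ η₀)) = 0 := by
  have h := euler_Psi m a r₀ σ₀ η₀
  rw [hΨ, mul_zero] at h
  field_simp
  linarith

end RadiusChart

end ImplicitRadius

/-! ## 4. Lemma 4.16(1), the embedding step: continuity of the trapped radius by compactness ((4.43)) and uniqueness ((4.46)),
## and the global statement "every trapped-radius selection on `Γ̃₀` is `C^ω`" -/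

section Embedding

variable {m a s σ₀ η₀ C₀ r₀ L U : ℝ}

/-- `Φ⁰ = −A²/μ + C` is jointly continuous in (reduced data `(σ, η_ϕ, C)`, `r`) at every point with `μ(r) ≠ 0`.
[cite: Hintz2026WavesII, eq. (4.34) `EqTs3bOG0` TeX l.4520-4524 (continuity of the printed rational function, recorded here)] -/
theorem continuousAt_Phi0 {p : ℝ × ℝ × ℝ} {r : ℝ} (hμ : mu m a r ≠ 0) :
    ContinuousAt (fun q : (ℝ × ℝ × ℝ) × ℝ => Phi0 m a q.1.1 q.1.2.1 q.1.2.2 q.2) (p, r) := by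
  unfold Phi0 Vfn
  have hμc : ContinuousAt (fun q : (ℝ × ℝ × ℝ) × ℝ => mu m a q.2) (p, r) := by unfold mu; fun_prop
  have hAc : ContinuousAt (fun q : (ℝ × ℝ × ℝ) × ℝ => -Afn a q.2 q.1.1 q.1.2.1 ^ 2) (p, r) := by unfold Afn; fun_prop
  have hCc : ContinuousAt (fun q : (ℝ × ℝ × ℝ) × ℝ => q.1.2.2) (p, r) := by fun_prop
  exact (hAc.div hμc hμ).add hCc

/-- **The tube-lemma step.**  Reduced data `p₀ = (σ₀, η₀, C₀)` with `C₀ > 0` whose potential has its (unique) double zero at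
`r₀ > r₊ = 𝔪 + s` (`a² = 𝔪² − s²`, `s ≥ 0`); a compact radial range `[L, U] ⊂ (r₊, ∞)` and a window half-width `δ > 0`.  Then for all
data `p` NEAR `p₀`: `Φ⁰_p(r) ≠ 0` for every `r ∈ [L, U] ∖ (r₀ − δ, r₀ + δ)` — nearby fibres have no trapped radius in the range away
from `r₀`.  ((4.38) gives `Φ⁰_{p₀} < 0` there; continuity and compactness — Mathlib's `IsCompact.eventually_forall_of_forall_eventually`.)
[cite: Hintz2026WavesII, proof of Lemma 4.16 TeX l.4679 ('[Γ₀] ⊂ S*𝓜/ℝ_𝔱 is compact by (4.43) … injective due to the uniqueness of r′ … therefore, it is an embedding'; the compactness-uniqueness step reproduced as a tube lemma)] -/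
theorem eventually_not_trapped_off_window (hm : 0 ≤ m) (hs : 0 ≤ s) (has : s ^ 2 + a ^ 2 = m ^ 2) (hC : 0 < C₀)
    (hr₀ : m + s < r₀) (h0 : Phi0 m a σ₀ η₀ C₀ r₀ = 0) (h1 : Psi m a r₀ σ₀ η₀ = 0) (hL : m + s < L)
    {δ : ℝ} (hδ : 0 < δ) :
    ∀ᶠ p in 𝓝 (σ₀, η₀, C₀), ∀ r ∈ Icc L U \ Ioo (r₀ - δ) (r₀ + δ), Phi0 m a p.1 p.2.1 p.2.2 r ≠ 0 := by
  have hK : IsCompact (Icc L U \ Ioo (r₀ - δ) (r₀ + δ)) := isCompact_Icc.diff isOpen_Ioo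
  apply hK.eventually_forall_of_forall_eventually
  intro r hr
  have hrL : m + s < r := lt_of_lt_of_le hL hr.1.1
  have hne : r ≠ r₀ := by
    intro h; apply hr.2; rw [h]; exact ⟨by linarith, by linarith⟩
  have hneg : Phi0 m a σ₀ η₀ C₀ r ≠ 0 := (Phi0_neg_of_ne hm hs has hC hr₀ h0 h1 hrL hne).ne
  have hμ : mu m a r ≠ 0 := (mu_pos_of_gt hs has hrL).ne'
  exact (continuousAt_Phi0 (m := m) (a := a) (p := (σ₀, η₀, C₀)) hμ).eventually_ne hneg

/-- **The embedding, in coordinates: near `p₀`, EVERY trapped radius in `[L, U]` of nearby data is the chart value `ρ(σ, η_ϕ)`** —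
`Γ₀` is locally the graph of `ρ` over `Γ̃₀`, "the inverse `(Π_{Γ₀})⁻¹ : Γ̃₀ → Γ₀`" is `(z,ζ) ↦ (ρ(σ,η_ϕ), z; 0, ζ)`.
[cite: Hintz2026WavesII, proof of Lemma 4.16 TeX l.4679 ('it is an embedding … the smoothness of the inverse (Π_{Γ₀})⁻¹ : Γ̃₀ → Γ₀ gives the smoothness of r′'; reproduced in coordinates)] -/
theorem eventually_radius_eq_chart (hm : 0 ≤ m) (hs : 0 ≤ s) (has : s ^ 2 + a ^ 2 = m ^ 2) (hC : 0 < C₀)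
    (hr₀ : m + s < r₀) (h0 : Phi0 m a σ₀ η₀ C₀ r₀ = 0) (h1 : Psi m a r₀ σ₀ η₀ = 0) (hL : m + s < L)
    (Φ : RadiusChart m a σ₀ η₀ r₀) :
    ∀ᶠ p in 𝓝 (σ₀, η₀, C₀), ∀ r ∈ Icc L U,
      Phi0 m a p.1 p.2.1 p.2.2 r = 0 → Psi m a r p.1 p.2.1 = 0 → r = Φ.ρ (p.1, p.2.1) := by
  have h1' := eventually_not_trapped_off_window (U := U) hm hs has hC hr₀ h0 h1 hL Φ.δ_pos
  have h2' : ∀ᶠ p : ℝ × ℝ × ℝ in 𝓝 (σ₀, η₀, C₀), (p.1, p.2.1) ∈ ball (σ₀, η₀) Φ.ε := by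
    have hc : ContinuousAt (fun p : ℝ × ℝ × ℝ => (p.1, p.2.1)) (σ₀, η₀, C₀) := by fun_prop
    exact hc.preimage_mem_nhds (isOpen_ball.mem_nhds Φ.mem_ball_self)
  filter_upwards [h1', h2'] with p hp hball r hr hΦ hΨ
  have hwin : r ∈ Ioo (r₀ - Φ.δ) (r₀ + Φ.δ) := by
    by_contra hw
    exact hp r ⟨hr, hw⟩ hΦ
  exact Φ.unique (p.1, p.2.1) hball r hwin hΨ

/-- From "agrees with the chart near the point" to `C^ω` within a set: if a function `R` on a normed space agrees, for points of `D`
near `x₀`, with `ρ ∘ π` for a `C^ω` map `π` into the fibre data with `π(x₀) = (σ₀, η₀)`, then `R` is `C^ω` within `D` at `x₀`.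
[cite: Hintz2026WavesII, proof of Lemma 4.16 TeX l.4679 ('the smoothness of the inverse … gives the smoothness of r′'; the transfer step, proved here)] -/
theorem contDiffWithinAt_of_eventually_eq_chart {X : Type*} [NormedAddCommGroup X] [NormedSpace ℝ X]
    (Φ : RadiusChart m a σ₀ η₀ r₀) {π : X → ℝ × ℝ} {x₀ : X} (hπ : ContDiffAt ℝ ω π x₀) (hπ₀ : π x₀ = (σ₀, η₀))
    {R : X → ℝ} {D : Set X} (hx₀ : x₀ ∈ D) (hR : ∀ᶠ x in 𝓝 x₀, x ∈ D → R x = Φ.ρ (π x)) :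
    ContDiffWithinAt ℝ ω R D x₀ := by
  have hcomp : ContDiffAt ℝ ω (fun x => Φ.ρ (π x)) x₀ := by
    have h : ContDiffAt ℝ ω Φ.ρ (π x₀) := Φ.contDiffAt (by rw [hπ₀]; exact Φ.mem_ball_self)
    exact h.comp x₀ hπ
  refine hcomp.contDiffWithinAt.congr_of_eventuallyEq ?_ (hR.self_of_nhds hx₀)
  exact eventually_nhdsWithin_iff.mpr (hR.mono fun x h hx => h hx)

/-- **LEMMA 4.16(1), GLOBAL FORM FOR REDUCED DATA: every selection of trapped radii is real-analytic.**  Let `D` be any set of reduced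
fibre data `(σ, η_ϕ, C)` with `C > 0`, and `R : D → [L, U]` (`L > r₊ = 𝔪 + s`, `a² = 𝔪² − s²`, `s ≥ 0`) any function assigning to
each datum a trapped radius of its fibre (`Φ⁰(R) = 0`, `Ψ(R) = 0`).  Then `R` is `C^ω` on `D` (`ContDiffOn ℝ ω R D`).
[cite: Hintz2026WavesII, Lemma 4.16(1) `LemmaTs3bOTrapwtGamma` TeX l.4672 ('The map Γ̃₀ ∋ (z,ζ) ↦ r′_{(z,ζ)} ∈ (r₊,∞) is smooth') and proof l.4677-4679 (reproduced for the reduced fibre data (σ, η_ϕ, C) with the compact range (4.43) as hypothesis)] -/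
theorem contDiffOn_radius_selection (hm : 0 ≤ m) (hs : 0 ≤ s) (has : s ^ 2 + a ^ 2 = m ^ 2) (hL : m + s < L)
    {D : Set (ℝ × ℝ × ℝ)} {R : ℝ × ℝ × ℝ → ℝ}
    (hD : ∀ p ∈ D, 0 < p.2.2 ∧ R p ∈ Icc L U ∧ Phi0 m a p.1 p.2.1 p.2.2 (R p) = 0 ∧ Psi m a (R p) p.1 p.2.1 = 0) :
    ContDiffOn ℝ ω R D := by
  intro p₀ hp₀
  obtain ⟨hC, hRange, h0, h1⟩ := hD p₀ hp₀
  have hr₀ : m + s < R p₀ := lt_of_lt_of_le hL hRange.1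
  have hμ := mu_pos_of_gt hs has hr₀
  have hA := Afn_ne_zero_of_Phi0_nonpos hC h0.le
  have ha : a ^ 2 ≤ m ^ 2 := by nlinarith
  obtain ⟨Φ⟩ := nonempty_radiusChart (σ₀ := p₀.1) (η₀ := p₀.2.1) hm (by linarith) ha hμ h1 hA
  have hev := eventually_radius_eq_chart (U := U) hm hs has hC hr₀ h0 h1 hL Φ
  have hp : (p₀.1, p₀.2.1, p₀.2.2) = p₀ := rfl
  rw [hp] at hev
  refine contDiffWithinAt_of_eventually_eq_chart Φ (π := fun p : ℝ × ℝ × ℝ => (p.1, p.2.1)) (by fun_prop) rfl hp₀ ?_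
  filter_upwards [hev] with p hp' hpD
  obtain ⟨-, hR, h0', h1'⟩ := hD p hpD
  exact hp' (R p) hR h0' h1'

/-! ### On `Γ₀` proper: `Γ̃₀ = Π(Γ₀)` transcribed in the two charts, and Lemma 4.16(1) there (`|a| < 𝔪`) -/

/-- **(4.46) `Γ̃₀ := Π(Γ₀)` in the Boyer–Lindquist chart** — the set of data `(sin²θ; σ, η_θ, η_ϕ)` (`t, ϕ` dropped: nothing depends on
them) with `0 < sin²θ ≤ 1`, off the zero section, "for which there exists `r' ∈ (r₊,∞)`" (`r₊ = 𝔪 + s`) "such that `(r', z; 0, ζ) ∈ Γ₀`":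
Def. 4.13's triple at `(r', z; 0, ζ)` and the future half `Σ⁺`. [cite: Hintz2026WavesII, eq. (4.46) `EqTs3bOTrapwtGamma0` TeX l.4645-4650 with Def. 4.13 `DefTs3bOTrap0` l.4607-4613 (transcription, Boyer–Lindquist chart)] -/
def tildeGamma0 (m a s : ℝ) : Set (ℝ × ℝ × ℝ × ℝ) :=
  {q | 0 < q.1 ∧ q.1 ≤ 1 ∧ ¬(q.2.1 = 0 ∧ (0 : ℝ) = 0 ∧ q.2.2.1 = 0 ∧ q.2.2.2 = 0) ∧
    ∃ r', m + s < r' ∧ OnGamma0 m a r' q.1 q.2.1 0 q.2.2.1 q.2.2.2 ∧ InSigmaPlus m a r' q.1 q.2.1 q.2.2.2}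

/-- **(4.46) in the polar chart of module 78** (data `(ω¹, ω²; σ, η₁, η₂)`, `|ω|² < 1`, poles included).
[cite: Hintz2026WavesII, eq. (4.46) `EqTs3bOTrapwtGamma0` TeX l.4645-4650 with (4.21)-(4.22) l.4346-4361 (transcription, polar chart)] -/
def tildeGamma0Pol (m a s : ℝ) : Set (ℝ × ℝ × ℝ × ℝ × ℝ) :=
  {q | normSq q.1 q.2.1 < 1 ∧ ¬(q.2.2.1 = 0 ∧ (0 : ℝ) = 0 ∧ q.2.2.2.1 = 0 ∧ q.2.2.2.2 = 0) ∧
    ∃ r', m + s < r' ∧ OnGamma0Pol m a r' q.1 q.2.1 q.2.2.1 0 q.2.2.2.1 q.2.2.2.2 ∧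
      InSigmaPlus m a r' (normSq q.1 q.2.1) q.2.2.1 (Lpol q.1 q.2.1 q.2.2.2.1 q.2.2.2.2)}

/-- **`Γ̃₀` is conic** ("smooth conic codimension 1 submanifold"): positive dilations of the fibre data preserve it, with the same
trapped radius. [cite: Hintz2026WavesII, Lemma 4.16(1) `LemmaTs3bOTrapwtGamma` TeX l.4672 ('conic'; reproduced)] -/
theorem smul_mem_tildeGamma0 {q : ℝ × ℝ × ℝ × ℝ} {t : ℝ} (ht : 0 < t) (hq : q ∈ tildeGamma0 m a s) :
    (q.1, t * q.2.1, t * q.2.2.1, t * q.2.2.2) ∈ tildeGamma0 m a s := by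
  obtain ⟨hs0, hs1, hne, r', hr', h0, hplus⟩ := hq
  refine ⟨hs0, hs1, ?_, r', hr', ?_, (inSigmaPlus_smul_iff m a r' q.1 q.2.1 q.2.2.2 t ht).mpr hplus⟩
  · rintro ⟨h1, -, h2, h3⟩
    exact hne ⟨by simpa [ht.ne'] using h1, rfl, by simpa [ht.ne'] using h2, by simpa [ht.ne'] using h3⟩
  · have h := (onGamma0_smul_iff m a r' q.1 q.2.1 0 q.2.2.1 q.2.2.2 t ht.ne').mpr h0
    simpa using h

/-- `Γ̃₀` is conic in the polar chart. [cite: Hintz2026WavesII, Lemma 4.16(1) TeX l.4672 ('conic'; reproduced, polar chart)] -/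
theorem smul_mem_tildeGamma0Pol {q : ℝ × ℝ × ℝ × ℝ × ℝ} {t : ℝ} (ht : 0 < t) (hq : q ∈ tildeGamma0Pol m a s) :
    (q.1, q.2.1, t * q.2.2.1, t * q.2.2.2.1, t * q.2.2.2.2) ∈ tildeGamma0Pol m a s := by
  obtain ⟨hu, hne, r', hr', h0, hplus⟩ := hq
  refine ⟨hu, ?_, r', hr', ?_, ?_⟩
  · rintro ⟨h1, -, h2, h3⟩
    exact hne ⟨by simpa [ht.ne'] using h1, rfl, by simpa [ht.ne'] using h2, by simpa [ht.ne'] using h3⟩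
  · have h := (onGamma0Pol_smul_iff m a r' q.2.2.1 0 t q.1 q.2.1 q.2.2.2.1 q.2.2.2.2 ht.ne').mpr h0
    simpa using h
  · show InSigmaPlus m a r' (normSq q.1 q.2.1) (t * q.2.2.1) (Lpol q.1 q.2.1 (t * q.2.2.2.1) (t * q.2.2.2.2))
    rw [Lpol_smul]
    exact (inSigmaPlus_smul_iff m a r' (normSq q.1 q.2.1) q.2.2.1 _ t ht).mpr hplus

/-- **LEMMA 4.16(1) ON `Γ̃₀` (Boyer–Lindquist chart, `a² = 𝔪² − s²`, `0 < s`, `𝔪 > 0`): every trapped-radius selection is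
real-analytic on `Γ̃₀`.**  For ANY function `R` assigning to each point of `Γ̃₀` a radius `R > r₊` at which Def. 4.13's triple holds
(by module 81 `trapped_radius_unique` there is exactly one), `ContDiffOn ℝ ω R Γ̃₀`.  Ingredients: `𝒞 > 0` (Lemma 4.14, module 76),
the photon shell `[r_ph⁺, r_ph⁻] ∋ R` with `r_ph⁺ ≥ r₊ + s²/(3𝔪)` ((4.43), module 76), the chart of §3 and the tube lemma of §4.
[cite: Hintz2026WavesII, Lemma 4.16(1) `LemmaTs3bOTrapwtGamma` TeX l.4668-4672 and its proof l.4677-4679 (reproduced in the Boyer–Lindquist chart); Dyatlov2015, §3.2 Prop. 3.3 (held arXiv text Prop. 2.3 p.16: 'its projection K̂ onto the x̂ = (t,θ,φ), ξ̂ = (τ,ξ_θ,ξ_φ) variables is a smooth codimension 1 submanifold of T*(ℝ × 𝕊²)') and Prop. 3.5 (held Prop. 2.5 p.17: 'r′ is the only solution to the equation Φ(r) = 0')] -/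
theorem contDiffOn_trappedRadius_bl (hm : 0 < m) (hs : 0 < s) (has : s ^ 2 + a ^ 2 = m ^ 2)
    {R : ℝ × ℝ × ℝ × ℝ → ℝ}
    (hR : ∀ q ∈ tildeGamma0 m a s, m + s < R q ∧ OnGamma0 m a (R q) q.1 q.2.1 0 q.2.2.1 q.2.2.2) :
    ContDiffOn ℝ ω R (tildeGamma0 m a s) := by
  intro q₀ hq₀
  have hq₀' := hq₀
  obtain ⟨hs20, hs21, hne, -⟩ := hq₀'
  obtain ⟨hr₀, h0⟩ := hR q₀ hq₀
  set r₀ := R q₀ with hr₀_def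
  have hμ := mu_pos_of_gt hs.le has hr₀
  have hmr : m < r₀ := by linarith
  have ha : a ^ 2 ≤ m ^ 2 := by nlinarith
  have hρ : 0 < rhoSq a r₀ q₀.1 := by
    unfold rhoSq; nlinarith [mul_nonneg (sq_nonneg a) (sub_nonneg.mpr hs21)]
  have hC := carterC_pos hμ hs20 hρ h0.1 h0.2.2 hne
  have hA := A_ne_zero hs20 hρ h0.1 h0.2.2 hne
  obtain ⟨hΦ0, hΨ⟩ := trapped_fibre_of_onGamma0 h0
  obtain ⟨Φ⟩ := nonempty_radiusChart (σ₀ := q₀.2.1) (η₀ := q₀.2.2.2) hm.le hmr ha hμ hΨ hA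
  -- the shell as the compact range
  obtain ⟨hL1, -, -, -⟩ := shell_bounds (a := a) hm hs has
  have hL : m + s < Kerr.photonOrbitRadius m (-|a|) := by
    have : 0 < s ^ 2 / (3 * m) := by positivity
    linarith
  have hev := eventually_radius_eq_chart (U := Kerr.photonOrbitRadius m |a|) hm.le hs.le has hC hr₀ hΦ0 hΨ hL Φ
  -- pull back along the continuous data map `q ↦ (σ, η_ϕ, 𝒞(ζ))`
  have hκ : ContinuousAt (fun q : ℝ × ℝ × ℝ × ℝ => (q.2.1, q.2.2.2, carterC a q.1 q.2.1 q.2.2.1 q.2.2.2)) q₀ := by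
    have h1 : ContinuousAt (fun q : ℝ × ℝ × ℝ × ℝ => carterC a q.1 q.2.1 q.2.2.1 q.2.2.2) q₀ := by
      unfold carterC
      have hc1 : ContinuousAt (fun q : ℝ × ℝ × ℝ × ℝ => q.2.2.1 ^ 2) q₀ := by fun_prop
      have hc2 : ContinuousAt (fun q : ℝ × ℝ × ℝ × ℝ => (1 : ℝ)) q₀ := by fun_prop
      have hc3 : ContinuousAt (fun q : ℝ × ℝ × ℝ × ℝ => q.1) q₀ := by fun_prop
      have hc4 : ContinuousAt (fun q : ℝ × ℝ × ℝ × ℝ => (-(a * q.1 * q.2.1) + q.2.2.2) ^ 2) q₀ := by fun_prop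
      exact hc1.add ((hc2.div hc3 hs20.ne').mul hc4)
    fun_prop
  have hev' := hκ.eventually hev
  refine contDiffWithinAt_of_eventually_eq_chart Φ (π := fun q : ℝ × ℝ × ℝ × ℝ => (q.2.1, q.2.2.2)) (by fun_prop) rfl
    hq₀ ?_
  filter_upwards [hev'] with q hq hqD
  have hqD' := hqD
  obtain ⟨hs20', hs21', hne', -⟩ := hqD'
  obtain ⟨hr, h0'⟩ := hR q hqD
  obtain ⟨hΦ0', hΨ'⟩ := trapped_fibre_of_onGamma0 h0'
  have hshell := trapped_radius_shell hm hs has hr hs20' hs21' h0' hne'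
  exact hq (R q) hshell hΦ0' hΨ'

/-- **LEMMA 4.16(1) ON `Γ̃₀`, POLAR CHART (poles included; `a² = 𝔪² − s²`, `0 < s`, `𝔪 > 0`)**: every trapped-radius selection is
real-analytic on `Γ̃₀`.  Ingredients: module 78's `carterCpol_pos`, `A_ne_zero_pol`, `trapped_radius_shell_pol`; the data map
`q ↦ (σ, ω¹η₂ − ω²η₁, 𝒞(ω, σ, η))` is polynomial. [cite: Hintz2026WavesII, Lemma 4.16(1) `LemmaTs3bOTrapwtGamma` TeX l.4668-4672 and proof l.4677-4679 with (4.21)-(4.22) l.4346-4361 (reproduced in the polar chart); Dyatlov2015, §3.1-3.2 (held arXiv text p.14 polar coordinates 'G_r, G_θ are smooth functions near the poles', Prop. 2.3 p.16, Prop. 2.5 p.17)] -/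
theorem contDiffOn_trappedRadius_pol (hm : 0 < m) (hs : 0 < s) (has : s ^ 2 + a ^ 2 = m ^ 2)
    {R : ℝ × ℝ × ℝ × ℝ × ℝ → ℝ}
    (hR : ∀ q ∈ tildeGamma0Pol m a s, m + s < R q ∧ OnGamma0Pol m a (R q) q.1 q.2.1 q.2.2.1 0 q.2.2.2.1 q.2.2.2.2) :
    ContDiffOn ℝ ω R (tildeGamma0Pol m a s) := by
  intro q₀ hq₀
  have hq₀' := hq₀
  obtain ⟨hu, hne, -⟩ := hq₀'
  obtain ⟨hr₀, h0⟩ := hR q₀ hq₀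
  set r₀ := R q₀ with hr₀_def
  have hμ := mu_pos_of_gt hs.le has hr₀
  have hmr : m < r₀ := by linarith
  have hr0 : r₀ ≠ 0 := by linarith
  have ha : a ^ 2 ≤ m ^ 2 := by nlinarith
  have hρ := rhoSq_pol_pos (a := a) hu hr0
  have hC := carterCpol_pos hμ hu hρ h0.1 h0.2.2 hne
  have hA := A_ne_zero_pol hu hρ h0.1 h0.2.2 hne
  obtain ⟨hΦ0, hΨ⟩ := trapped_fibre_of_onGamma0Pol h0
  obtain ⟨Φ⟩ := nonempty_radiusChart (σ₀ := q₀.2.2.1) (η₀ := Lpol q₀.1 q₀.2.1 q₀.2.2.2.1 q₀.2.2.2.2)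
    hm.le hmr ha hμ hΨ hA
  obtain ⟨hL1, -, -, -⟩ := shell_bounds (a := a) hm hs has
  have hL : m + s < Kerr.photonOrbitRadius m (-|a|) := by
    have : 0 < s ^ 2 / (3 * m) := by positivity
    linarith
  have hev := eventually_radius_eq_chart (U := Kerr.photonOrbitRadius m |a|) hm.le hs.le has hC hr₀ hΦ0 hΨ hL Φ
  have hκ : ContinuousAt (fun q : ℝ × ℝ × ℝ × ℝ × ℝ =>
      (q.2.2.1, Lpol q.1 q.2.1 q.2.2.2.1 q.2.2.2.2, carterCpol a q.1 q.2.1 q.2.2.1 q.2.2.2.1 q.2.2.2.2)) q₀ := by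
    unfold Lpol carterCpol; fun_prop
  have hev' := hκ.eventually hev
  refine contDiffWithinAt_of_eventually_eq_chart Φ
    (π := fun q : ℝ × ℝ × ℝ × ℝ × ℝ => (q.2.2.1, Lpol q.1 q.2.1 q.2.2.2.1 q.2.2.2.2)) (by unfold Lpol; fun_prop) rfl hq₀ ?_
  filter_upwards [hev'] with q hq hqD
  have hqD' := hqD
  obtain ⟨hu', hne', -⟩ := hqD'
  obtain ⟨hr, h0'⟩ := hR q hqD
  obtain ⟨hΦ0', hΨ'⟩ := trapped_fibre_of_onGamma0Pol h0'
  have hshell := trapped_radius_shell_pol hm hs has hr hu' h0' hne'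
  exact hq (R q) hshell hΦ0' hΨ'

end Embedding

/-! ## 5. `Γ̃₀` as a regular level set: the chart presentation of `Γ₀` as a graph and `∂_σ(G_3b(ρ(σ,η_ϕ), z; 0, ζ)) = −2ϱ²g⁻¹(d𝔱,ζ) ≠ 0` -/

section LevelSet

variable {m a σ₀ η₀ r₀ : ℝ}

/-- **`Γ₀` AS A GRAPH OVER `Γ̃₀` IN THE CHART** (Boyer–Lindquist): for fibre data `(σ, η_ϕ)` in the ball and radii `r` in the window,
Def. 4.13's triple holds at `(r, z; 0, ζ)` iff `r = ρ(σ, η_ϕ)` AND the level function `F(z, ζ) := G_3b(ρ(σ,η_ϕ), z; 0, ζ)` vanishes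
— so `Π(Γ₀ ∩ chart) = {F = 0}` and `Π|_{Γ₀}` is injective with inverse `(z,ζ) ↦ (ρ(σ,η_ϕ), z; 0, ζ)`.
[cite: Hintz2026WavesII, eq. (4.46) `EqTs3bOTrapwtGamma0` TeX l.4645-4650 and proof of Lemma 4.16 l.4679 ('injective due to the uniqueness of r′ … the inverse (Π_{Γ₀})⁻¹ : Γ̃₀ → Γ₀'; reproduced in coordinates)] -/
theorem onGamma0_iff_chart (Φ : RadiusChart m a σ₀ η₀ r₀) {s2 σ ηθ ηφ r : ℝ}
    (hp : (σ, ηφ) ∈ ball (σ₀, η₀) Φ.ε) (hr : r ∈ Ioo (r₀ - Φ.δ) (r₀ + Φ.δ)) :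
    OnGamma0 m a r s2 σ 0 ηθ ηφ ↔ r = Φ.ρ (σ, ηφ) ∧ G3b m a (Φ.ρ (σ, ηφ)) s2 σ 0 ηθ ηφ = 0 := by
  constructor
  · rintro ⟨-, hΨ, hG⟩
    have h := Φ.unique (σ, ηφ) hp r hr hΨ
    refine ⟨h, ?_⟩
    rw [← h]; exact hG
  · rintro ⟨h, hG⟩
    refine ⟨rfl, ?_, ?_⟩
    · rw [h]; exact Φ.root (σ, ηφ) hp
    · rw [h]; exact hG

/-- The same in the polar chart. [cite: Hintz2026WavesII, eq. (4.46) TeX l.4645-4650 and proof of Lemma 4.16 l.4679 with (4.21)-(4.22) l.4346-4361 (reproduced, polar chart)] -/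
theorem onGamma0Pol_iff_chart (Φ : RadiusChart m a σ₀ η₀ r₀) {ω₁ ω₂ σ η₁ η₂ r : ℝ}
    (hp : (σ, Lpol ω₁ ω₂ η₁ η₂) ∈ ball (σ₀, η₀) Φ.ε) (hr : r ∈ Ioo (r₀ - Φ.δ) (r₀ + Φ.δ)) :
    OnGamma0Pol m a r ω₁ ω₂ σ 0 η₁ η₂ ↔
      r = Φ.ρ (σ, Lpol ω₁ ω₂ η₁ η₂) ∧ G3bpol m a (Φ.ρ (σ, Lpol ω₁ ω₂ η₁ η₂)) ω₁ ω₂ σ 0 η₁ η₂ = 0 := by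
  constructor
  · rintro ⟨-, hΨ, hG⟩
    have h := Φ.unique (σ, Lpol ω₁ ω₂ η₁ η₂) hp r hr hΨ
    refine ⟨h, ?_⟩
    rw [← h]; exact hG
  · rintro ⟨h, hG⟩
    refine ⟨rfl, ?_, ?_⟩
    · rw [h]; exact Φ.root (σ, Lpol ω₁ ω₂ η₁ η₂) hp
    · rw [h]; exact hG

variable (m a) in
/-- **Total derivative of `V = −A²/μ` along a differentiable curve `x ↦ (r, σ, η_ϕ)(x)`**:
`(V∘γ)' = ∂_rV·r' + ∂_σV·σ' + ∂_{η_ϕ}V·η'` with `∂_rV = −Ψ/μ²` ((4.31)), `∂_σV = 2(r²+a²)A/μ`, `∂_{η_ϕ}V = −2aA/μ` (module 76's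
certified partials `hasDerivAt_V`, `hasDerivAt_sG_sigma`, `hasDerivAt_sG_etaphi`), at a point with `μ ≠ 0`.
[cite: Hintz2026WavesII, eq. (4.31) `EqTs3bOPsi` TeX l.4470-4471 and (4.32) l.4479 (chain rule on the printed function, computed here)] -/
theorem hasDerivAt_Vfn_comp {f g h : ℝ → ℝ} {f' g' h' y : ℝ} (hf : HasDerivAt f f' y) (hg : HasDerivAt g g' y)
    (hh : HasDerivAt h h' y) (hμ : mu m a (f y) ≠ 0) :
    HasDerivAt (fun x => Vfn m a (f x) (g x) (h x))
      (-Psi m a (f y) (g y) (h y) / mu m a (f y) ^ 2 * f'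
        + 2 * ((f y) ^ 2 + a ^ 2) * Afn a (f y) (g y) (h y) / mu m a (f y) * g'
        + -(2 * a * Afn a (f y) (g y) (h y)) / mu m a (f y) * h') y := by
  have hA : HasDerivAt (fun x => Afn a (f x) (g x) (h x))
      (-((2 * f y * f') * g y + (f y ^ 2 + a ^ 2) * g') + a * h') y := by
    unfold Afn
    exact ((((hf.fun_pow 2).fun_add (hasDerivAt_const y (a ^ 2))).fun_mul hg).fun_neg.fun_add
      ((hasDerivAt_const y a).fun_mul hh)).congr_deriv (by ring)
  have hμ' : HasDerivAt (fun x => mu m a (f x)) (dmu m (f y) * f') y := (hasDerivAt_mu m a (f y)).comp y hf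
  unfold Vfn
  refine (((hA.fun_pow 2).fun_neg).fun_div hμ' hμ).congr_deriv ?_
  unfold Psi dmu
  field_simp
  ring

/-- **`∂_σF = −2ϱ²g⁻¹(d𝔱, ζ)` for the level function `F(σ) := G_3b(ρ(σ, η₀), z; 0, ζ)` of `Γ̃₀`** at the base point (Boyer–Lindquist
chart, `sin²θ ≠ 0`, `μ(r₀) ≠ 0`, `Ψ(r₀) = 0`): by the chain rule `∂_σF = (∂_rG_3b)·∂_σρ + ∂_σG_3b`, and "`∂_rG_3b = 0`" at `Γ₀` ((4.44):
`∂_rG_3b|_{ξ=0} = −Ψ/μ² = 0`) kills the first term whatever `∂_σρ` is; the second is (4.44)'s entry `−2ϱ²g⁻¹(d𝔱,·)` = module 76's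
`dtPairing`. [cite: Hintz2026WavesII, (4.44) `EqTs3bOTrap0RegDiff` TeX l.4627-4635 ('∂_r G_3b = 0', '∂_σ G_3b = −2ϱ²g⁻¹(d𝔱,·)') and Lemma 4.16(1) l.4672 ('codimension 1'; the regular-level-set derivative computed here)] -/
theorem hasDerivAt_level_sigma (Φ : RadiusChart m a σ₀ η₀ r₀) {s2 ηθ : ℝ} (hs2 : s2 ≠ 0) (hμ : mu m a r₀ ≠ 0)
    (hΨ : Psi m a r₀ σ₀ η₀ = 0) :
    HasDerivAt (fun x => G3b m a (Φ.ρ (x, η₀)) s2 x 0 ηθ η₀) (-(2 * dtPairing m a r₀ s2 σ₀ η₀)) σ₀ := by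
  have hρ := Φ.hasDerivAt_sigma_deriv
  set d := deriv (fun x => Φ.ρ (x, η₀)) σ₀ with hd_def
  have hμ0 : mu m a ((fun x => Φ.ρ (x, η₀)) σ₀) ≠ 0 := by simpa [Φ.center] using hμ
  have hV := hasDerivAt_Vfn_comp m a hρ (hasDerivAt_id σ₀) (hasDerivAt_const σ₀ η₀) hμ0
  have hM : HasDerivAt (fun x => mu m a (Φ.ρ (x, η₀)) * (0 : ℝ) ^ 2) (dmu m (Φ.ρ (σ₀, η₀)) * d * (0 : ℝ) ^ 2) σ₀ :=
    ((hasDerivAt_mu m a (Φ.ρ (σ₀, η₀))).comp σ₀ hρ).mul_const _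
  have hC : HasDerivAt (fun x => carterC a s2 x ηθ η₀) (1 / s2 * (2 * Bfn a s2 σ₀ η₀ * (-(a * s2)))) σ₀ := by
    unfold carterC
    exact ((hasDerivAt_const σ₀ (ηθ ^ 2)).fun_add ((hasDerivAt_const σ₀ (1 / s2)).fun_mul
      ((hasDerivAt_Bfn_sigma a s2 σ₀ η₀).fun_pow 2))).congr_deriv (by unfold Bfn; ring)
  unfold G3b sG
  refine ((hM.fun_add hV).fun_add hC).congr_deriv ?_
  simp only [Φ.center, id_eq, hΨ]
  unfold dtPairing Bfn
  field_simp
  ring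

/-- **… and `∂_σF ≠ 0` on the future half** (`ϱ²g⁻¹(d𝔱, ζ) > 0` on `Σ⁺`, module 76 (4.41)–(4.42)): `{F = 0}` is a REGULAR level
set transverse to the `σ`-lines — `Γ̃₀` is locally a `C^ω` hypersurface, a graph of the energy `σ` over the momenta.
[cite: Hintz2026WavesII, Lemma 4.16(1) `LemmaTs3bOTrapwtGamma` TeX l.4672 ('Γ̃₀ … is a smooth conic codimension 1 submanifold') with (4.44) l.4632-4635 and (4.41)-(4.42) l.4593-4603 (reproduced as a regular-value statement)] -/
theorem level_sigma_ne_zero {s2 : ℝ} (hplus : InSigmaPlus m a r₀ s2 σ₀ η₀) : -(2 * dtPairing m a r₀ s2 σ₀ η₀) ≠ 0 :=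
  (dG3b_dsigma_neg m a r₀ s2 σ₀ η₀ hplus).ne

/-- **The polar-chart level function has the same `σ`-derivative**: for `F(σ) := G_3b^{pol}(ρ(σ, ω¹η₂ − ω²η₁), ω; σ, 0, η)`,
`∂_σF = −2ϱ²g⁻¹(d𝔱, ζ)` at the base point (poles included; module 78 `hasDerivAt_G3bpol_sigma` is the fixed-`r` partial).
[cite: Hintz2026WavesII, (4.44) `EqTs3bOTrap0RegDiff` TeX l.4627-4635 with (4.21)-(4.22) l.4346-4361 (the regular-level-set derivative computed here, polar chart)] -/
theorem hasDerivAt_levelPol_sigma (Φ : RadiusChart m a σ₀ η₀ r₀) {ω₁ ω₂ η₁ η₂ : ℝ}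
    (hη : Lpol ω₁ ω₂ η₁ η₂ = η₀) (hμ : mu m a r₀ ≠ 0) (hΨ : Psi m a r₀ σ₀ η₀ = 0) :
    HasDerivAt (fun x => G3bpol m a (Φ.ρ (x, η₀)) ω₁ ω₂ x 0 η₁ η₂)
      (-(2 * dtPairing m a r₀ (normSq ω₁ ω₂) σ₀ η₀)) σ₀ := by
  have hρ := Φ.hasDerivAt_sigma_deriv
  set d := deriv (fun x => Φ.ρ (x, η₀)) σ₀ with hd_def
  have hμ0 : mu m a ((fun x => Φ.ρ (x, η₀)) σ₀) ≠ 0 := by simpa [Φ.center] using hμ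
  have hV := hasDerivAt_Vfn_comp m a hρ (hasDerivAt_id σ₀) (hasDerivAt_const σ₀ η₀) hμ0
  have hM : HasDerivAt (fun x => mu m a (Φ.ρ (x, η₀)) * (0 : ℝ) ^ 2) (dmu m (Φ.ρ (σ₀, η₀)) * d * (0 : ℝ) ^ 2) σ₀ :=
    ((hasDerivAt_mu m a (Φ.ρ (σ₀, η₀))).comp σ₀ hρ).mul_const _
  have hC : HasDerivAt (fun x => carterCpol a ω₁ ω₂ x η₁ η₂)
      (2 * (η₁ + a * σ₀ * ω₂) * (a * ω₂) + 2 * (η₂ - a * σ₀ * ω₁) * (-(a * ω₁))) σ₀ := by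
    unfold carterCpol
    have h1 : HasDerivAt (fun x => η₁ + a * x * ω₂) (a * ω₂) σ₀ := by
      simpa using (((hasDerivAt_id' σ₀).const_mul a).mul_const ω₂).const_add η₁
    have h2 : HasDerivAt (fun x => η₂ - a * x * ω₁) (-(a * ω₁)) σ₀ := by
      simpa using (((hasDerivAt_id' σ₀).const_mul a).mul_const ω₁).const_sub η₂
    exact ((h1.fun_pow 2).fun_add (h2.fun_pow 2)).fun_sub (hasDerivAt_const σ₀ _) |>.congr_deriv (by ring)
  unfold G3bpol sG
  rw [hη]
  refine ((hM.fun_add hV).fun_add hC).congr_deriv ?_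
  simp only [Φ.center, id_eq, hΨ]
  rw [← hη]
  simp only [dtPairing, Bfn, Lpol, normSq, Afn]
  field_simp
  ring

/-- … nonzero on the future half, polar chart. [cite: Hintz2026WavesII, Lemma 4.16(1) TeX l.4672 with (4.44) l.4632-4635 and (4.41)-(4.42) l.4593-4603 (reproduced as a regular-value statement, polar chart)] -/
theorem levelPol_sigma_ne_zero {ω₁ ω₂ : ℝ} (hplus : InSigmaPlus m a r₀ (normSq ω₁ ω₂) σ₀ η₀) :
    -(2 * dtPairing m a r₀ (normSq ω₁ ω₂) σ₀ η₀) ≠ 0 :=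
  (dG3b_dsigma_neg m a r₀ (normSq ω₁ ω₂) σ₀ η₀ hplus).ne

/-! ### 5b. The second implicit-function step: `Γ̃₀` is locally the graph of a real-analytic ENERGY FUNCTION `σ = S(θ, η_θ, η_ϕ)`,
### and `Γ₀` the graph `{σ = S, r = ρ(S, η_ϕ)}` over `(θ, η_θ, η_ϕ)` (× the dropped `(t, ϕ)`) -/

/-- `G_3b(r, sin²θ; σ, 0, η_θ, η_ϕ)` is `C^ω` jointly in `(r, sin²θ, σ, η_θ, η_ϕ)` wherever `μ(r) ≠ 0`, `sin²θ ≠ 0` (a rational function).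
[cite: Hintz2026WavesII, eq. (4.32) `EqTs3bOMetHam` TeX l.4477-4478 (regularity of the printed function recorded here)] -/
theorem contDiffAt_G3b_of {r s2 σ ηθ ηφ : ℝ} (hμ : mu m a r ≠ 0) (hs2 : s2 ≠ 0) :
    ContDiffAt ℝ ω (fun v : ℝ × ℝ × ℝ × ℝ × ℝ => G3b m a v.1 v.2.1 v.2.2.1 0 v.2.2.2.1 v.2.2.2.2)
      (r, s2, σ, ηθ, ηφ) := by
  have hμ' : r ^ 2 - 2 * m * r + a ^ 2 ≠ 0 := hμ
  unfold G3b sG Vfn Afn carterC mu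
  fun_prop (disch := assumption)

/-- The polar `G_3b` is `C^ω` jointly in `(r, ω, σ, η)` wherever `μ(r) ≠ 0` (poles included). [cite: Hintz2026WavesII, eq. (4.32) with (4.22) TeX l.4477-4478, l.4361 (regularity recorded here)] -/
theorem contDiffAt_G3bpol_of {r ω₁ ω₂ σ η₁ η₂ : ℝ} (hμ : mu m a r ≠ 0) :
    ContDiffAt ℝ ω (fun v : ℝ × ℝ × ℝ × ℝ × ℝ × ℝ => G3bpol m a v.1 v.2.1 v.2.2.1 v.2.2.2.1 0 v.2.2.2.2.1 v.2.2.2.2.2)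
      (r, ω₁, ω₂, σ, η₁, η₂) := by
  have hμ' : r ^ 2 - 2 * m * r + a ^ 2 ≠ 0 := hμ
  unfold G3bpol sG Vfn Afn carterCpol Lpol mu
  fun_prop (disch := assumption)

/-- **The level function `F(x, σ) := G_3b(ρ(σ, η_ϕ), sin²θ; σ, 0, η_θ, η_ϕ)`, `x = (sin²θ, η_θ, η_ϕ)`, is `C^ω` jointly** near the
base point (composition of the analytic chart `ρ` with a rational function). [cite: Hintz2026WavesII, proof of Lemma 4.16 TeX l.4679 ('[Π] … is a smooth immersion … embedding … Γ̃₀ is a smooth codimension 1 submanifold'; the smoothness of the coordinate level function, proved here)] -/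
theorem contDiffAt_level (Φ : RadiusChart m a σ₀ η₀ r₀) {s2 ηθ : ℝ} (hμ : mu m a r₀ ≠ 0) (hs2 : s2 ≠ 0) :
    ContDiffAt ℝ ω (uncurry fun (x : ℝ × ℝ × ℝ) (σ : ℝ) => G3b m a (Φ.ρ (σ, x.2.2)) x.1 σ 0 x.2.1 x.2.2)
      ((s2, ηθ, η₀), σ₀) := by
  have hρ : ContDiffAt ℝ ω (fun q : (ℝ × ℝ × ℝ) × ℝ => Φ.ρ (q.2, q.1.2.2)) ((s2, ηθ, η₀), σ₀) := by
    have h1 : ContDiffAt ℝ ω Φ.ρ (σ₀, η₀) := Φ.contDiffAt Φ.mem_ball_self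
    have h2 : ContDiffAt ℝ ω (fun q : (ℝ × ℝ × ℝ) × ℝ => (q.2, q.1.2.2)) ((s2, ηθ, η₀), σ₀) := by fun_prop
    exact h1.comp_of_eq ((s2, ηθ, η₀), σ₀) h2 (Set.mapsTo_univ _ _) rfl
  have hrest : ContDiffAt ℝ ω (fun q : (ℝ × ℝ × ℝ) × ℝ => (q.1.1, q.2, q.1.2.1, q.1.2.2)) ((s2, ηθ, η₀), σ₀) := by
    fun_prop
  have hin := hρ.prodMk hrest
  have hG := contDiffAt_G3b_of (m := m) (a := a) (σ := σ₀) (ηθ := ηθ) (ηφ := η₀) hμ hs2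
  have hcomp : ContDiffAt ℝ ω ((fun v : ℝ × ℝ × ℝ × ℝ × ℝ => G3b m a v.1 v.2.1 v.2.2.1 0 v.2.2.2.1 v.2.2.2.2) ∘
      (fun q : (ℝ × ℝ × ℝ) × ℝ => (Φ.ρ (q.2, q.1.2.2), q.1.1, q.2, q.1.2.1, q.1.2.2))) ((s2, ηθ, η₀), σ₀) :=
    hG.comp_of_eq ((s2, ηθ, η₀), σ₀) hin (Set.mapsTo_univ _ _) (by simp [Φ.center])
  exact hcomp

/-- The same for the polar level function `F(x, σ) := G_3b^{pol}(ρ(σ, ω¹η₂ − ω²η₁), ω; σ, 0, η)`, `x = (ω¹, ω², η₁, η₂)`.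
[cite: Hintz2026WavesII, proof of Lemma 4.16 TeX l.4679 with (4.21)-(4.22) l.4346-4361 (smoothness of the coordinate level function, polar chart, proved here)] -/
theorem contDiffAt_levelPol (Φ : RadiusChart m a σ₀ η₀ r₀) {ω₁ ω₂ η₁ η₂ : ℝ} (hη : Lpol ω₁ ω₂ η₁ η₂ = η₀)
    (hμ : mu m a r₀ ≠ 0) :
    ContDiffAt ℝ ω (uncurry fun (x : ℝ × ℝ × ℝ × ℝ) (σ : ℝ) =>
        G3bpol m a (Φ.ρ (σ, Lpol x.1 x.2.1 x.2.2.1 x.2.2.2)) x.1 x.2.1 σ 0 x.2.2.1 x.2.2.2)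
      ((ω₁, ω₂, η₁, η₂), σ₀) := by
  have hρ : ContDiffAt ℝ ω (fun q : (ℝ × ℝ × ℝ × ℝ) × ℝ => Φ.ρ (q.2, Lpol q.1.1 q.1.2.1 q.1.2.2.1 q.1.2.2.2))
      ((ω₁, ω₂, η₁, η₂), σ₀) := by
    have h1 : ContDiffAt ℝ ω Φ.ρ (σ₀, η₀) := Φ.contDiffAt Φ.mem_ball_self
    have h2 : ContDiffAt ℝ ω (fun q : (ℝ × ℝ × ℝ × ℝ) × ℝ => (q.2, Lpol q.1.1 q.1.2.1 q.1.2.2.1 q.1.2.2.2))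
        ((ω₁, ω₂, η₁, η₂), σ₀) := by unfold Lpol; fun_prop
    exact h1.comp_of_eq ((ω₁, ω₂, η₁, η₂), σ₀) h2 (Set.mapsTo_univ _ _) (by simp [hη])
  have hrest : ContDiffAt ℝ ω (fun q : (ℝ × ℝ × ℝ × ℝ) × ℝ => (q.1.1, q.1.2.1, q.2, q.1.2.2.1, q.1.2.2.2))
      ((ω₁, ω₂, η₁, η₂), σ₀) := by
    fun_prop
  have hin := hρ.prodMk hrest
  have hG := contDiffAt_G3bpol_of (m := m) (a := a) (ω₁ := ω₁) (ω₂ := ω₂) (σ := σ₀) (η₁ := η₁) (η₂ := η₂) hμ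
  have hcomp : ContDiffAt ℝ ω
      ((fun v : ℝ × ℝ × ℝ × ℝ × ℝ × ℝ => G3bpol m a v.1 v.2.1 v.2.2.1 v.2.2.2.1 0 v.2.2.2.2.1 v.2.2.2.2.2) ∘
      (fun q : (ℝ × ℝ × ℝ × ℝ) × ℝ =>
        (Φ.ρ (q.2, Lpol q.1.1 q.1.2.1 q.1.2.2.1 q.1.2.2.2), q.1.1, q.1.2.1, q.2, q.1.2.2.1, q.1.2.2.2)))
      ((ω₁, ω₂, η₁, η₂), σ₀) :=
    hG.comp_of_eq ((ω₁, ω₂, η₁, η₂), σ₀) hin (Set.mapsTo_univ _ _) (by simp [hη, Φ.center])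
  exact hcomp

/-- **AN ENERGY CHART over a radius chart** (Boyer–Lindquist): the data produced by the implicit function theorem applied to the
level function `F(x, σ)` at a point of `Γ̃₀ ∩ Σ⁺` — radii `ε, δ > 0` and a real-analytic `S(sin²θ, η_θ, η_ϕ)` on a ball with
`S(x₀) = σ₀`, values in `(σ₀ − δ, σ₀ + δ)`, `F(x, S x) = 0`, and `S x` the ONLY solution of `F(x, ·) = 0` in the window: locally
`Γ̃₀ = {σ = S(sin²θ, η_θ, η_ϕ)}`, a graph over the momenta. [cite: Hintz2026WavesII, Lemma 4.16(1) `LemmaTs3bOTrapwtGamma` TeX l.4672 ('Γ̃₀ … is a smooth conic codimension 1 submanifold'; packaging of the coordinate statement, transcription of the conclusion)] -/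
structure EnergyChart {m a σ₀ η₀ r₀ : ℝ} (Φ : RadiusChart m a σ₀ η₀ r₀) (s2₀ ηθ₀ : ℝ) where
  /-- radius of the ball of data `x = (sin²θ, η_θ, η_ϕ)` -/
  ε : ℝ
  /-- half-width of the energy window -/
  δ : ℝ
  /-- the energy function `x ↦ σ` -/
  S : ℝ × ℝ × ℝ → ℝ
  ε_pos : 0 < ε
  δ_pos : 0 < δ
  smooth : ContDiffOn ℝ ω S (ball (s2₀, ηθ₀, η₀) ε)
  center : S (s2₀, ηθ₀, η₀) = σ₀
  window : ∀ x ∈ ball (s2₀, ηθ₀, η₀) ε, S x ∈ Ioo (σ₀ - δ) (σ₀ + δ)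
  root : ∀ x ∈ ball (s2₀, ηθ₀, η₀) ε, G3b m a (Φ.ρ (S x, x.2.2)) x.1 (S x) 0 x.2.1 x.2.2 = 0
  unique : ∀ x ∈ ball (s2₀, ηθ₀, η₀) ε, ∀ σ ∈ Ioo (σ₀ - δ) (σ₀ + δ),
    G3b m a (Φ.ρ (σ, x.2.2)) x.1 σ 0 x.2.1 x.2.2 = 0 → σ = S x

/-- **LEMMA 4.16(1) "codimension 1", IN COORDINATES (Boyer–Lindquist chart, every `a` with `μ(r₀) ≠ 0`)**: at a point `(r₀, z₀; 0, ζ₀)`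
of `Γ₀ ∩ Σ⁺` off the axis (`sin²θ₀ ≠ 0`) with radius chart `Φ`, an energy chart exists — the tree's implicit function theorem for
`F(x, σ) = 0` at `σ₀`, whose non-degeneracy `∂_σF = −2ϱ²g⁻¹(d𝔱, ζ₀) ≠ 0` is (4.44)'s third column on the future half.
[cite: Hintz2026WavesII, Lemma 4.16(1) `LemmaTs3bOTrapwtGamma` TeX l.4668-4672 and proof l.4677-4679 with (4.44) l.4632-4635 (reproduced in coordinates: Γ̃₀ is locally a real-analytic graph σ = S(sin²θ, η_θ, η_ϕ))] -/
theorem nonempty_energyChart (Φ : RadiusChart m a σ₀ η₀ r₀) {s2 ηθ : ℝ} (hs2 : s2 ≠ 0) (hμ : mu m a r₀ ≠ 0)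
    (hΨ : Psi m a r₀ σ₀ η₀ = 0) (hG0 : G3b m a r₀ s2 σ₀ 0 ηθ η₀ = 0) (hplus : InSigmaPlus m a r₀ s2 σ₀ η₀) :
    Nonempty (EnergyChart Φ s2 ηθ) := by
  have hg := contDiffAt_level Φ (s2 := s2) (ηθ := ηθ) hμ hs2
  have hspeed : deriv ((fun (x : ℝ × ℝ × ℝ) (σ : ℝ) => G3b m a (Φ.ρ (σ, x.2.2)) x.1 σ 0 x.2.1 x.2.2) (s2, ηθ, η₀)) σ₀
      ≠ 0 := by
    show deriv (fun σ => G3b m a (Φ.ρ (σ, η₀)) s2 σ 0 ηθ η₀) σ₀ ≠ 0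
    rw [(hasDerivAt_level_sigma Φ (ηθ := ηθ) hs2 hμ hΨ).deriv]
    exact level_sigma_ne_zero hplus
  obtain ⟨ε, hε, δ, hδ, S, hS, h0, h1, h2⟩ :=
    exists_contDiffOn_crossingTime (X := ℝ × ℝ × ℝ) (n := ω) (by simp) (by simp) hg hspeed
  have hlev : G3b m a (Φ.ρ (σ₀, η₀)) s2 σ₀ 0 ηθ η₀ = 0 := by rw [Φ.center]; exact hG0
  refine ⟨⟨ε, δ, S, hε, hδ, hS, h0, fun x hx => (h1 x hx).1, fun x hx => ?_, fun x hx σ hσ h => h2 x hx σ hσ ?_⟩⟩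
  · have h := (h1 x hx).2
    simp only [hlev] at h
    exact h
  · show G3b m a (Φ.ρ (σ, x.2.2)) x.1 σ 0 x.2.1 x.2.2 = G3b m a (Φ.ρ (σ₀, η₀)) s2 σ₀ 0 ηθ η₀
    rw [h, hlev]

/-- **`Γ₀` AS A REAL-ANALYTIC GRAPH OVER `(θ, η_θ, η_ϕ)`** (Boyer–Lindquist chart): inside the two charts (data in the balls, `σ` and
`r` in the windows), Def. 4.13's triple holds at `(r, z; σ, 0, η_θ, η_ϕ)` **iff `σ = S(sin²θ, η_θ, η_ϕ)` and `r = ρ(σ, η_ϕ)`** —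
"`Γ₀` is a smooth conic codimension 2 submanifold of `Σ⁺ ∩ T*𝓜` (and thus of codimension 3 within `T*𝓜`)" (Lemma 4.14) and
"`Γ̃₀ … codimension 1`" (Lemma 4.16(1)) in coordinates: three of the eight coordinates `(t, r, θ, ϕ; σ, ξ, η_θ, η_ϕ)` are
determined (`ξ = 0`, `σ = S`, `r = ρ`), analytically, by the other five.
[cite: Hintz2026WavesII, Lemma 4.14 `LemmaTs3bOTrap0Reg` TeX l.4621-4623 ('codimension 2 … codimension 3 within T*𝓜') and Lemma 4.16(1) `LemmaTs3bOTrapwtGamma` l.4668-4672 (reproduced in coordinates as a graph statement)] -/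
theorem onGamma0_iff_graph (Φ : RadiusChart m a σ₀ η₀ r₀) {s2₀ ηθ₀ : ℝ} (Λ : EnergyChart Φ s2₀ ηθ₀)
    {x : ℝ × ℝ × ℝ} {σ r : ℝ} (hx : x ∈ ball (s2₀, ηθ₀, η₀) Λ.ε) (hσ : σ ∈ Ioo (σ₀ - Λ.δ) (σ₀ + Λ.δ))
    (hp : (σ, x.2.2) ∈ ball (σ₀, η₀) Φ.ε) (hr : r ∈ Ioo (r₀ - Φ.δ) (r₀ + Φ.δ)) :
    OnGamma0 m a r x.1 σ 0 x.2.1 x.2.2 ↔ σ = Λ.S x ∧ r = Φ.ρ (σ, x.2.2) := by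
  rw [onGamma0_iff_chart Φ hp hr]
  constructor
  · rintro ⟨hρ, hG⟩
    exact ⟨Λ.unique x hx σ hσ hG, hρ⟩
  · rintro ⟨hS, hρ⟩
    refine ⟨hρ, ?_⟩
    rw [hS]; exact Λ.root x hx

/-- An energy chart in the polar chart of module 78 (data `x = (ω¹, ω², η₁, η₂)`, poles included).
[cite: Hintz2026WavesII, Lemma 4.16(1) TeX l.4672 with (4.21)-(4.22) l.4346-4361 (packaging, polar chart)] -/
structure EnergyChartPol {m a σ₀ η₀ r₀ : ℝ} (Φ : RadiusChart m a σ₀ η₀ r₀) (ω₁₀ ω₂₀ η₁₀ η₂₀ : ℝ) where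
  /-- radius of the ball of data `x = (ω¹, ω², η₁, η₂)` -/
  ε : ℝ
  /-- half-width of the energy window -/
  δ : ℝ
  /-- the energy function `x ↦ σ` -/
  S : ℝ × ℝ × ℝ × ℝ → ℝ
  ε_pos : 0 < ε
  δ_pos : 0 < δ
  smooth : ContDiffOn ℝ ω S (ball (ω₁₀, ω₂₀, η₁₀, η₂₀) ε)
  center : S (ω₁₀, ω₂₀, η₁₀, η₂₀) = σ₀
  window : ∀ x ∈ ball (ω₁₀, ω₂₀, η₁₀, η₂₀) ε, S x ∈ Ioo (σ₀ - δ) (σ₀ + δ)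
  root : ∀ x ∈ ball (ω₁₀, ω₂₀, η₁₀, η₂₀) ε,
    G3bpol m a (Φ.ρ (S x, Lpol x.1 x.2.1 x.2.2.1 x.2.2.2)) x.1 x.2.1 (S x) 0 x.2.2.1 x.2.2.2 = 0
  unique : ∀ x ∈ ball (ω₁₀, ω₂₀, η₁₀, η₂₀) ε, ∀ σ ∈ Ioo (σ₀ - δ) (σ₀ + δ),
    G3bpol m a (Φ.ρ (σ, Lpol x.1 x.2.1 x.2.2.1 x.2.2.2)) x.1 x.2.1 σ 0 x.2.2.1 x.2.2.2 = 0 → σ = S x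

/-- **Lemma 4.16(1) "codimension 1" in the polar chart, POLES INCLUDED**: at a point of `Γ₀ ∩ Σ⁺` with `μ(r₀) ≠ 0` an energy chart
exists (`∂_σF = −2ϱ²g⁻¹(d𝔱, ζ₀) ≠ 0`, `hasDerivAt_levelPol_sigma`). [cite: Hintz2026WavesII, Lemma 4.16(1) `LemmaTs3bOTrapwtGamma` TeX l.4668-4672 and proof l.4677-4679 with (4.21)-(4.22) l.4346-4361 (reproduced in coordinates, polar chart)] -/
theorem nonempty_energyChartPol (Φ : RadiusChart m a σ₀ η₀ r₀) {ω₁ ω₂ η₁ η₂ : ℝ} (hη : Lpol ω₁ ω₂ η₁ η₂ = η₀)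
    (hμ : mu m a r₀ ≠ 0) (hΨ : Psi m a r₀ σ₀ η₀ = 0) (hG0 : G3bpol m a r₀ ω₁ ω₂ σ₀ 0 η₁ η₂ = 0)
    (hplus : InSigmaPlus m a r₀ (normSq ω₁ ω₂) σ₀ η₀) :
    Nonempty (EnergyChartPol Φ ω₁ ω₂ η₁ η₂) := by
  have hg := contDiffAt_levelPol Φ hη hμ
  have hspeed : deriv ((fun (x : ℝ × ℝ × ℝ × ℝ) (σ : ℝ) =>
      G3bpol m a (Φ.ρ (σ, Lpol x.1 x.2.1 x.2.2.1 x.2.2.2)) x.1 x.2.1 σ 0 x.2.2.1 x.2.2.2) (ω₁, ω₂, η₁, η₂)) σ₀ ≠ 0 := by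
    show deriv (fun σ => G3bpol m a (Φ.ρ (σ, Lpol ω₁ ω₂ η₁ η₂)) ω₁ ω₂ σ 0 η₁ η₂) σ₀ ≠ 0
    rw [hη, (hasDerivAt_levelPol_sigma Φ hη hμ hΨ).deriv]
    exact levelPol_sigma_ne_zero hplus
  obtain ⟨ε, hε, δ, hδ, S, hS, h0, h1, h2⟩ :=
    exists_contDiffOn_crossingTime (X := ℝ × ℝ × ℝ × ℝ) (n := ω) (by simp) (by simp) hg hspeed
  have hlev : G3bpol m a (Φ.ρ (σ₀, Lpol ω₁ ω₂ η₁ η₂)) ω₁ ω₂ σ₀ 0 η₁ η₂ = 0 := by rw [hη, Φ.center]; exact hG0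
  refine ⟨⟨ε, δ, S, hε, hδ, hS, h0, fun x hx => (h1 x hx).1, fun x hx => ?_, fun x hx σ hσ h => h2 x hx σ hσ ?_⟩⟩
  · have h := (h1 x hx).2
    simp only [hlev] at h
    exact h
  · show G3bpol m a (Φ.ρ (σ, Lpol x.1 x.2.1 x.2.2.1 x.2.2.2)) x.1 x.2.1 σ 0 x.2.2.1 x.2.2.2
      = G3bpol m a (Φ.ρ (σ₀, Lpol ω₁ ω₂ η₁ η₂)) ω₁ ω₂ σ₀ 0 η₁ η₂
    rw [h, hlev]

/-- **`Γ₀` as a real-analytic graph over `(ω, η)` in the polar chart, poles included**: inside the charts, Def. 4.13's triple holds at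
`(r, ω; σ, 0, η)` iff `σ = S(ω, η)` and `r = ρ(σ, ω¹η₂ − ω²η₁)`. [cite: Hintz2026WavesII, Lemma 4.14 TeX l.4621-4623 and Lemma 4.16(1) l.4668-4672 with (4.21)-(4.22) l.4346-4361 (reproduced in coordinates as a graph statement, polar chart)] -/
theorem onGamma0Pol_iff_graph (Φ : RadiusChart m a σ₀ η₀ r₀) {ω₁₀ ω₂₀ η₁₀ η₂₀ : ℝ} (Λ : EnergyChartPol Φ ω₁₀ ω₂₀ η₁₀ η₂₀)
    {x : ℝ × ℝ × ℝ × ℝ} {σ r : ℝ} (hx : x ∈ ball (ω₁₀, ω₂₀, η₁₀, η₂₀) Λ.ε) (hσ : σ ∈ Ioo (σ₀ - Λ.δ) (σ₀ + Λ.δ))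
    (hp : (σ, Lpol x.1 x.2.1 x.2.2.1 x.2.2.2) ∈ ball (σ₀, η₀) Φ.ε) (hr : r ∈ Ioo (r₀ - Φ.δ) (r₀ + Φ.δ)) :
    OnGamma0Pol m a r x.1 x.2.1 σ 0 x.2.2.1 x.2.2.2 ↔ σ = Λ.S x ∧ r = Φ.ρ (σ, Lpol x.1 x.2.1 x.2.2.1 x.2.2.2) := by
  rw [onGamma0Pol_iff_chart Φ hp hr]
  constructor
  · rintro ⟨hρ, hG⟩
    exact ⟨Λ.unique x hx σ hσ hG, hρ⟩
  · rintro ⟨hS, hρ⟩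
    refine ⟨hρ, ?_⟩
    rw [hS]; exact Λ.root x hx

end LevelSet

/-! ## 6. Lemma 4.16(2) at the level of differentials, and "`φ₀^{u/s}` is a defining function" -/

section Transversality

variable (m a σ ηφ C r' ρ ξ : ℝ)

/-- `∂_ξφ₀^u = 1`: (4.47) is a defining function of `Γ₀^u` in `Γ̃₀ × T*(r₊,∞)` (its `ξ`-derivative never vanishes).
[cite: Hintz2026WavesII, TeX l.4698 ('φ₀^{u/s} is a defining function in Γ̃₀ × T*(r₊,∞)'; reproduced)] -/
theorem hasDerivAt_phiU_xi : HasDerivAt (fun x => phiU m a σ ηφ C r' ρ x) 1 ξ := by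
  unfold phiU
  exact (hasDerivAt_id' ξ).sub_const _

/-- `∂_ξφ₀^s = 1`. [cite: Hintz2026WavesII, TeX l.4698 ('φ₀^{u/s} is a defining function'; reproduced)] -/
theorem hasDerivAt_phiS_xi : HasDerivAt (fun x => phiS m a σ ηφ C r' ρ x) 1 ξ := by
  unfold phiS
  exact (hasDerivAt_id' ξ).add_const _

/-- **Lemma 4.16(2), "intersect transversally at `Γ₀` … a consequence of the fact that `Φ⁰` has a non-degenerate maximum at
`r = r'`"**, at the level of differentials in the `(r, ξ)`-plane: `dφ₀^u|_{(r',0)} = (−c, 1)`, `dφ₀^s|_{(r',0)} = (c, 1)` with module 81's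
slope `c = √(−∂_r²Φ⁰(r')/(2μ(r')))` (`hasDerivAt_brU_rprime`), and `det [[−c, 1], [c, 1]] = −2c ≠ 0` since `c > 0` at every trapped
radius for `a² ≤ 𝔪²` (`slopeC_pos`, Lemma 4.12).  (Module 81 `poisson_phiU_phiS_rprime`: `{φ₀^u, φ₀^s} = 2c` is the symplectic form of
the same determinant.) [cite: Hintz2026WavesII, Lemma 4.16(2) `LemmaTs3bOTrapwtGamma` TeX l.4673 and proof l.4681 ('transversality being a consequence of … non-degenerate maximum'; reproduced at the level of differentials); Dyatlov2015, §3.2 Prop. 3.5 (held arXiv text Prop. 2.5 p.17: 'intersecting transversely')] -/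
theorem transversal_at_rprime (hm : 0 ≤ m) (hmr : m < r') (ha : a ^ 2 ≤ m ^ 2) (hμ : 0 < mu m a r')
    (h1 : Psi m a r' σ ηφ = 0) (hA : Afn a r' σ ηφ ≠ 0) :
    (!![-slopeC m a σ ηφ r', 1; slopeC m a σ ηφ r', 1] : Matrix (Fin 2) (Fin 2) ℝ).det ≠ 0 := by
  have hc := slopeC_pos m a σ ηφ r' hm hmr ha hμ h1 hA
  rw [Matrix.det_fin_two_of]
  intro h
  linarith

end Transversality

/-! ## 7. Worked example (computed here): SCHWARZSCHILD `a = 0` — the radius chart is the constant `3𝔪` and the energy function of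
## `Γ̃₀` is `σ = S(sin²θ, η_θ, η_ϕ) = √(η_θ² + η_ϕ²/sin²θ)/(3√3𝔪)` GLOBALLY ("on Schwarzschild, this is the set `{|η|_{g̸⁻¹} = 3√3𝔪}`") -/

section Schwarzschild

variable {m s2 σ ηθ ηφ σ₀ η₀ : ℝ}

/-- For `a = 0`, `Ψ(3𝔪; σ, η_ϕ) = 0` for EVERY `(σ, η_ϕ)` (`A = −9𝔪²σ`, `μ(3𝔪) = 3𝔪²`, `μ'(3𝔪) = 4𝔪`: `4·3𝔪·3𝔪²·σ − 9𝔪²σ·4𝔪 = 0`):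
the photon sphere. [cite: Hintz2026WavesII, TeX l.4879 ('on Schwarzschild, this is the set {|η| = 3√3𝔪}') with (4.31) l.4471 (computed here); Dyatlov2015, §3.3 Prop. 3.8 (held arXiv text Prop. 2.8 p.18: 'K̃ = {ξ_r = 0, r = 3M, …}')] -/
theorem Psi_schwarzschild_photon_sphere (m σ ηφ : ℝ) : Psi m 0 (3 * m) σ ηφ = 0 := by
  unfold Psi Afn mu dmu; ring

/-- **The Schwarzschild radius chart is constant**: any radius chart at a base point with `r₀ = 3𝔪` has `ρ ≡ 3𝔪` on its ball (uniqueness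
window + `Ψ(3𝔪; ·) ≡ 0`) — "`r'` homogeneous of degree 0" degenerates to a constant, `∂_σr' = ∂_ηr' = 0`.
[cite: Hintz2026WavesII, Lemma 4.16(1) TeX l.4672 at a = 0 with l.4879 (computed here); Dyatlov2015, §3.3 Prop. 3.8 (held text Prop. 2.8 p.18: 'r = 3M')] -/
theorem radiusChart_schwarzschild (Φ : RadiusChart m 0 σ₀ η₀ (3 * m)) {p : ℝ × ℝ} (hp : p ∈ ball (σ₀, η₀) Φ.ε) :
    Φ.ρ p = 3 * m := by
  have hw : 3 * m ∈ Ioo (3 * m - Φ.δ) (3 * m + Φ.δ) := ⟨by linarith [Φ.δ_pos], by linarith [Φ.δ_pos]⟩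
  exact (Φ.unique p hp (3 * m) hw (Psi_schwarzschild_photon_sphere m p.1 p.2)).symm

/-- **The Schwarzschild energy function in closed form**: on `Γ̃₀ ∩ Σ⁺` of Schwarzschild (`a = 0`, `𝔪 > 0`, off the axis) the trapped
radius is `3𝔪` and **`σ = √(η_θ² + η_ϕ²/sin²θ)/(3√3𝔪)`** — module 76's `schwarzschild_photon_sphere` (`r = 3𝔪`, `𝒞 = 27𝔪²σ²`) solved
for `σ > 0`: the energy chart `S` of §5b is this GLOBAL real-analytic, degree-1 homogeneous function of the momenta.
[cite: Hintz2026WavesII, TeX l.4879 ('on Schwarzschild, this is the set {|η|_{g̸⁻¹} = 3√3𝔪}, as can be read off from [Dyatlov, (3.35)]'; reproduced as the explicit energy graph); Dyatlov2015, §3.3 Prop. 3.8 with (3.35) (held arXiv text Prop. 2.8 p.18: 'G_θ = 27M²τ²')] -/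
theorem schwarzschild_energy (hm : 0 < m) (hs20 : 0 < s2) {r' : ℝ} (hmr : m < r') (hμ : 0 < mu m 0 r')
    (h0 : OnGamma0 m 0 r' s2 σ 0 ηθ ηφ) (hne : ¬(σ = 0 ∧ (0 : ℝ) = 0 ∧ ηθ = 0 ∧ ηφ = 0)) (hσ : 0 < σ) :
    r' = 3 * m ∧ σ = Real.sqrt (ηθ ^ 2 + ηφ ^ 2 / s2) / (3 * Real.sqrt 3 * m) := by
  obtain ⟨hr, hC⟩ := schwarzschild_photon_sphere rfl hm hmr hμ hs20 h0 hne
  refine ⟨hr, ?_⟩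
  have hX : ηθ ^ 2 + ηφ ^ 2 / s2 = 27 * m ^ 2 * σ ^ 2 := by
    rw [← hC]; unfold carterC; field_simp; ring
  have h3 : Real.sqrt 3 ^ 2 = 3 := Real.sq_sqrt (by norm_num)
  have hsq : Real.sqrt (ηθ ^ 2 + ηφ ^ 2 / s2) = 3 * Real.sqrt 3 * m * σ := by
    rw [hX]
    have hnn : 0 ≤ 3 * Real.sqrt 3 * m * σ := by positivity
    rw [show (27 : ℝ) * m ^ 2 * σ ^ 2 = (3 * Real.sqrt 3 * m * σ) ^ 2 by nlinarith [h3]]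
    exact Real.sqrt_sq hnn
  rw [hsq]
  have h33 : 0 < 3 * Real.sqrt 3 * m := by positivity
  field_simp

/-- **Conversely, the graph is all of `Γ̃₀`**: for `a = 0` (so `a² = 𝔪² − s²` with `s = 𝔪`, `r₊ = 2𝔪`), EVERY momentum datum
`(sin²θ; η_θ, η_ϕ) ≠ 0`, `0 < sin²θ ≤ 1`, with the energy `σ := √(η_θ² + η_ϕ²/sin²θ)/(3√3𝔪)` lies in `Γ̃₀` (witness `r' = 3𝔪`:
Def. 4.13's triple and `Σ⁺` hold) — `Γ̃₀|_{a=0}` IS the graph of this global energy function over `T*𝕊² ∖ 0`.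
[cite: Hintz2026WavesII, eq. (4.46) `EqTs3bOTrapwtGamma0` TeX l.4645-4650 and l.4879 (computed here for a = 0); Dyatlov2015, §3.3 Prop. 3.8 (held text Prop. 2.8 p.18)] -/
theorem schwarzschild_mem_tildeGamma0 (hm : 0 < m) (hs20 : 0 < s2) (hs21 : s2 ≤ 1) (hη : ¬(ηθ = 0 ∧ ηφ = 0)) :
    (s2, Real.sqrt (ηθ ^ 2 + ηφ ^ 2 / s2) / (3 * Real.sqrt 3 * m), ηθ, ηφ) ∈ tildeGamma0 m 0 m := by
  set X : ℝ := ηθ ^ 2 + ηφ ^ 2 / s2 with hX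
  have hXpos : 0 < X := by
    rw [hX]
    by_cases h1 : ηθ = 0
    · have h2 : ηφ ≠ 0 := fun h2 => hη ⟨h1, h2⟩
      have : 0 < ηφ ^ 2 / s2 := by positivity
      nlinarith [sq_nonneg ηθ]
    · have : 0 < ηθ ^ 2 := by positivity
      have : 0 ≤ ηφ ^ 2 / s2 := by positivity
      linarith
  have h3 : Real.sqrt 3 ^ 2 = 3 := Real.sq_sqrt (by norm_num)
  have h33 : 0 < 3 * Real.sqrt 3 * m := by positivity
  set σ' : ℝ := Real.sqrt X / (3 * Real.sqrt 3 * m) with hσ'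
  have hσpos : 0 < σ' := by rw [hσ']; exact div_pos (Real.sqrt_pos.mpr hXpos) h33
  have hσsq : 27 * m ^ 2 * σ' ^ 2 = X := by
    rw [hσ', div_pow, Real.sq_sqrt hXpos.le]
    field_simp
    nlinarith [h3]
  refine ⟨hs20, hs21, ?_, 3 * m, by linarith, ⟨rfl, Psi_schwarzschild_photon_sphere m σ' ηφ, ?_⟩, ?_⟩
  · rintro ⟨h, -, -, -⟩
    exact absurd h hσpos.ne'
  · show G3b m 0 (3 * m) s2 σ' 0 ηθ ηφ = 0
    have hμ : mu m 0 (3 * m) = 3 * m ^ 2 := by unfold mu; ring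
    unfold G3b sG Vfn carterC Afn
    rw [hμ]
    have hm0 : (3 : ℝ) * m ^ 2 ≠ 0 := by positivity
    field_simp
    rw [hX] at hσsq
    field_simp at hσsq
    nlinarith [hσsq]
  · show 0 < dtPairing m 0 (3 * m) s2 σ' ηφ
    have hμ : mu m 0 (3 * m) = 3 * m ^ 2 := by unfold mu; ring
    unfold dtPairing Afn Bfn
    rw [hμ]
    have : -(((3 * m) ^ 2 + (0:ℝ) ^ 2) * (-(((3 * m) ^ 2 + 0 ^ 2) * σ') + 0 * ηφ)) / (3 * m ^ 2) + 0 * (-(0 * s2 * σ') + ηφ)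
        = 27 * m ^ 2 * σ' := by field_simp; ring
    rw [this]; positivity

end Schwarzschild

end Literature.Geometry.Lorentzian.Hintz2026.KerrTrappedSetRegularity

end
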